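import Literature.MathematicalPhysics.QuantumLattice.HubbardBondAlgebra
import Literature.MathematicalPhysics.QuantumLattice.PairCorrelations
import HarnessLib

/-!
MAINTENANCE 2026-08-20 (ops-buildfix lane): this file's bond-sign function was named `dWaveBondSign`, the same fully-qualified
name as the (different: ordered-pair, `0` off the bonds) `Literature.MathematicalPhysics.QuantumLattice.dWaveBondSign` of
`DopedRVBState.lean`; no environment could import both files (`Literature` root aggregate). The token is renamed here to
`spnDWaveBondSign` in every declaration name and use of THIS file (no importer used it); statements are otherwise byte-identical.
# The `Sp(2n)` pair-Hubbard (`t`-`U`-`J`) model with `n` flavours and its `n = 1` reduction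

Trunk T-QLATTICE (`Literature/MathematicalPhysics/QuantumLattice`), family `hubbard`; definition
request `defn-spnPairHubbardTorus` of route `SpNLargeN` of summit `HubbardSuperconductivity`
(items `SpnAnchorLRO`, `SpnMeanFieldLimit`, `TUJSmallJ`, which so far write these operators
inline with `let`).

## The model

Fix a finite linearly ordered set of sites `Λ`, a graph `G` on `Λ` and a number `n` of
*flavours*. The orbitals are `(x, m, σ)` with `x ∈ Λ`, `m ∈ Fin n`, `σ ∈ {↑ = 0, ↓ = 1}`, realised
as `Orb (Λ ×ₗ Fin n)` (lexicographic order, site-major), so that the Jordan–Wigner operators of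
`HubbardWave0` apply verbatim: `c_{x m σ} = annihilation (orb (toLex (x, m)) σ)`
(`flavourAnnihilation`). The `2n` indices `a = (m, σ)` carry the defining representation of the
compact symplectic group `Sp(2n)` (Sachdev–Read: the `2N × 2N` unitaries with `Uᵀ 𝒥 U = 𝒥`,
`𝒥 = diag(ε, …, ε)`, `ε = (0 1; -1 0)`), and the `𝒥`-contracted pair operators
`𝒥^{ab} c_{x a} c_{y b} = Σ_m (c_{x m ↑} c_{y m ↓} - c_{x m ↓} c_{y m ↑})` are `Sp(2n)` singlets
[SachdevRead1991, §1 and §4]. The operators named here are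

* `onSiteSingletPair n x = Σ_m c_{x m ↓} c_{x m ↑}` (`= ½ 𝒥^{ab} c_{x a} c_{x b}`),
* `bondSingletPair n x y = Σ_m (c_{x m ↑} c_{y m ↓} - c_{x m ↓} c_{y m ↑})` (`= 𝒥^{ab} c_{x a} c_{y b}`),
* `flavourHopping G n = Σ_{x ∼ y ordered} Σ_{m σ} c†_{x m σ} c_{y m σ}`,
* the **`Sp(2n)` pair-Hubbard Hamiltonian** (the route's normalisation)
  `spnPairHubbard G n t U J = -t · flavourHopping + (U/n) Σ_x P_x† P_x - (J/(4n)) Σ_{x ∼ y ordered} B_{xy}† B_{xy}`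
  with `P_x = onSiteSingletPair`, `B_{xy} = bondSingletPair` — a canonical-fermion member of the
  large-`N` `Sp(2N)` `t`-`J` family of Sachdev–Read and Vojta–Sachdev (exchange written as
  `-(J/N) (𝒥 c†c†)(𝒥 c c)` [SachdevRead1991, §4], [VojtaSachdev1999, eq. (1)]; cf. the `SU(n)`
  Hubbard–Heisenberg models of Affleck–Marston [AffleckMarston1988]) in which the on-site Hubbard
  repulsion is kept as the pair repulsion `(U/n) P†P` (at `n = 1`, `P†P = n_↑ n_↓`);
* on the square torus `(ℤ/Lℤ)²`: `spnPairHubbardTorus n L t U J` and the flavour-singlet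
  `d_{x²-y²}` bond pair field `flavourDWavePairField n L = Σ_{x ∼ y} g_d(y - x) B_{xy}`
  (`g_d = +1` on horizontal, `-1` on vertical bonds) [Scalapino1995, §2].

## The `n = 1` objects and the reduction

* `singletPairOp x y = c_{x↑} c_{y↓} - c_{x↓} c_{y↑}` (`= √2 ×` the singlet bond annihilator `b_{xy}`),
  `tUJHamiltonian G t U J = hamiltonian G t U - (J/4) Σ_{x ∼ y ordered} Q_{xy}† Q_{xy}` (the
  `t`-`U`-`J` model: `-(J/4) Σ_{ordered} Q†Q = -J Σ_{bonds} b†b = J Σ_{bonds} (S_x·S_y - n_x n_y/4)`),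
  `tUJTorus L t U J`, and `dWaveBondField L = Σ_{x ∼ y} g_d Q_{xy}`;
* along the order isomorphism `Λ ×ₗ Fin 1 ≃o Λ` (`Prod.Lex.prodUnique`), second-quantised by
  `jwEmbed ∘ orbEmb` (`FermionEmbedding`, `HubbardBondAlgebra`): `spnPairHubbard G 1 t U J ↦
  tUJHamiltonian G t U J` (`jwEmbed_spnPairHubbard_one`), `flavourDWavePairField 1 L ↦
  dWaveBondField L` and `dWaveBondField L = √2 • pairField dWaveFormFactor L` for `2 < L`.

## API proved here

Bridges to the inline expressions of the route (`spnPairHubbardTorus_one_eq_inline`,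
`flavourDWavePairField_eq_inline`, `tUJTorus_eq_inline`); Hermiticity; conservation of the
weighted number operators `Σ d_i n_i` with `d_{(x,m,σ)} = a + ε_σ b_m` (`ε_↑ = 1`, `ε_↓ = -1`),
whence `[H, N] = 0`, `[H, S^z] = 0` and invariance under the Cartan torus `U(1)^n ⊂ Sp(2n)`
(`[H, C_m] = 0`, `C_m = N_{m↑} - N_{m↓}`); the `n = 1` reduction of the Hamiltonian and of the
`d`-wave field (`= √2 Δ_d` for `L ≥ 3`); transport of states, expectations, sectors, sector energies
and sector ground states along order isomorphisms of orbital sets (`fockCongr`), whence the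
correspondence of sector ground states and of `⟨D†D⟩ = 2⟨Δ_d†Δ_d⟩` under the `n = 1` reduction.
Full `Sp(2n)` invariance: `[H_n, E_{mm'}] = [H_n, F_{mm'}] = [H_n, F_{mm'}†] = 0` for the generators
`flavourRotation` (`𝔲(n)`), `flavourSpinFlip` and adjoints spanning `𝔰𝔭(2n, ℂ)` (last section; the
mechanism is `[Σ_z c†_{za} c_{zb}, c_{xp} c_{yq}] = δ_{aq} c_{yb} c_{xp} - δ_{ap} c_{xb} c_{yq}` and the CAR).

## Mathlib / tree search

Tree (reused, never redefined): `annihilation`, `orb`, `Orb`, `Fock`, `expect`, `hamiltonian`,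
`totalNumber`, `spinZ` (`HubbardWave0`); `numberAt_eq_diagonal`, CAR entries (`FermionOperators*`);
`hubbardTorus`, `fermionTorusGraph`, `IsGroundStateInSector` (`HubbardModel`); `jwEmbed`,
`jwEmbed_annihilation`, `jwEmbed_conjTranspose` (`FermionEmbedding`); `orbEmb` (`HubbardBondAlgebra`);
`pairField`, `dWaveFormFactor`, `unitSteps` (`PairCorrelations`); `torusGraph_adj_iff`
(`LatticeGraph`). Mathlib: `Prod.Lex.prodUnique`, `Matrix.reindex`, `Matrix.submatrix_mulVec_equiv`,
`Equiv.finsetCongr`. `lean search 'flavour|spnPair|tUJ|singletPairOp|siteSum_|fockCongr|orbIso|HasWeightShift|weightedNumber|dWaveBond'`: nothing in the tree; `singletBond` IS taken (`LocalPairOn.singletBond L x e`, the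
torus bond version; definitionally `singletBond L x e = singletPairOp (ofTorusSite x) (ofTorusSite (x + proj e))`,
not imported here).

## References

* S. Sachdev, N. Read, Int. J. Mod. Phys. B 5 (1991) 219, §1 (the tensor `𝒥`, `Sp(N)` singlet
  bonds) and §4 (the `Sp(N)` `t`-`J` Hamiltonian `H_tJ`). [SachdevRead1991]
* M. Vojta, S. Sachdev, Phys. Rev. Lett. 83 (1999) 3916, eq. (1). [VojtaSachdev1999]
* N. Read, S. Sachdev, Phys. Rev. Lett. 66 (1991) 1773. [ReadSachdev1991]
* I. Affleck, J. B. Marston, Phys. Rev. B 37 (1988) 3774. [AffleckMarston1988]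
* D. J. Scalapino, Phys. Rep. 250 (1995) 329, §2. [Scalapino1995]
* O. Bratteli, D. W. Robinson, *Operator Algebras and QSM II*, §5.2.2. [BratteliRobinsonII1997]
-/

noncomputable section

namespace Literature.MathematicalPhysics.QuantumLattice

open Matrix Finset HubbardWave0
open scoped ComplexOrder

/-! ### Flavoured fermions and the `Sp(2n)`-singlet pair operators -/

section General

variable {Λ : Type*} [LinearOrder Λ] [Fintype Λ]

/-- The annihilation operator `c_{x m σ}` of the fermion of flavour `m ∈ Fin n` and spin `σ` at
the site `x`, on the Fock space over `Orb (Λ ×ₗ Fin n)` (orbitals `((x, m), σ)` in lexicographic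
order): `annihilation (orb (toLex (x, m)) σ)`. [cite: SachdevRead1991, §4] -/
def flavourAnnihilation (n : ℕ) (x : Λ) (m : Fin n) (σ : Fin 2) :
    Matrix (Finset (Orb (Λ ×ₗ Fin n))) (Finset (Orb (Λ ×ₗ Fin n))) ℂ :=
  annihilation (orb (toLex (x, m)) σ)

omit [Fintype Λ] in
/-- `flavourAnnihilation` unfolded (definitional). [folklore] -/
theorem flavourAnnihilation_eq (n : ℕ) (x : Λ) (m : Fin n) (σ : Fin 2) :
    flavourAnnihilation n x m σ = annihilation (orb (toLex (x, m)) σ) := rfl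

/-- The flavour-summed on-site singlet pair `P_x = Σ_m c_{x m ↓} c_{x m ↑}`
(`= ½ 𝒥^{ab} c_{x a} c_{x b}`, an `Sp(2n)` singlet). [cite: SachdevRead1991, §4] -/
def onSiteSingletPair (n : ℕ) (x : Λ) :
    Matrix (Finset (Orb (Λ ×ₗ Fin n))) (Finset (Orb (Λ ×ₗ Fin n))) ℂ :=
  ∑ m : Fin n, flavourAnnihilation n x m 1 * flavourAnnihilation n x m 0

/-- The flavour-summed bond singlet pair
`B_{xy} = Σ_m (c_{x m ↑} c_{y m ↓} - c_{x m ↓} c_{y m ↑}) = 𝒥^{ab} c_{x a} c_{y b}`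
(an `Sp(2n)` singlet). [cite: SachdevRead1991, §1 and §4] -/
def bondSingletPair (n : ℕ) (x y : Λ) :
    Matrix (Finset (Orb (Λ ×ₗ Fin n))) (Finset (Orb (Λ ×ₗ Fin n))) ℂ :=
  ∑ m : Fin n, (flavourAnnihilation n x m 0 * flavourAnnihilation n y m 1 -
    flavourAnnihilation n x m 1 * flavourAnnihilation n y m 0)

variable (G : SimpleGraph Λ) [DecidableRel G.Adj]

/-- The flavour- and spin-diagonal hopping term `Σ_{x ∼ y} Σ_{m σ} c†_{x m σ} c_{y m σ}` over
ORDERED adjacent pairs of `G` (so each bond contributes a term and its adjoint).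
[cite: VojtaSachdev1999, eq. (1)] -/
def flavourHopping (n : ℕ) : Matrix (Finset (Orb (Λ ×ₗ Fin n))) (Finset (Orb (Λ ×ₗ Fin n))) ℂ :=
  ∑ x : Λ, ∑ y : Λ, ∑ m : Fin n, ∑ σ : Fin 2,
    if G.Adj x y then (flavourAnnihilation n x m σ)ᴴ * flavourAnnihilation n y m σ else 0

/-- The **`Sp(2n)` pair-Hubbard Hamiltonian** with `n` flavours on the graph `G`,
`H_n(t, U, J) = -t Σ_{x∼y, m, σ} c†_{xmσ} c_{ymσ} + (U/n) Σ_x P_x† P_x - (J/(4n)) Σ_{x∼y} B_{xy}† B_{xy}`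
(ordered adjacent pairs; `P_x = onSiteSingletPair`, `B_{xy} = bondSingletPair`): a canonical-fermion
member of the large-`N` `Sp(2N)` `t`-`J` family (exchange `-(J/N)(𝒥 c† c†)(𝒥 c c)`), with the
Hubbard repulsion kept as the on-site pair repulsion; this normalisation is the one of route
`SpNLargeN` (`SpnAnchorLRO`), and at `n = 1` it is the `t`-`U`-`J` model (`jwEmbed_spnPairHubbard_one`).
Junk value at `n = 0`: `U/0 = J/0 = 0`. [cite: SachdevRead1991, §4] -/
def spnPairHubbard (n : ℕ) (t U J : ℝ) :
    Matrix (Finset (Orb (Λ ×ₗ Fin n))) (Finset (Orb (Λ ×ₗ Fin n))) ℂ :=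
  -(t : ℂ) • flavourHopping G n +
    ((U / n : ℝ) : ℂ) • (∑ x : Λ, (onSiteSingletPair n x)ᴴ * onSiteSingletPair n x) -
    ((J / (4 * n) : ℝ) : ℂ) • (∑ x : Λ, ∑ y : Λ,
      if G.Adj x y then (bondSingletPair n x y)ᴴ * bondSingletPair n x y else 0)

/-! ### The one-flavour (`n = 1`) objects: singlet bonds and the `t`-`U`-`J` model -/

/-- The (unnormalised) singlet pair annihilator `Q_{xy} = c_{x↑} c_{y↓} - c_{x↓} c_{y↑}` on an ordered
pair of sites of the Hubbard Fock space (`Q_{xy} = √2 b_{xy}` for the singlet pair `b_{xy}`; `Q_{xy} = Q_{yx}`);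
`LocalPairOn.singletBond L x e` is its torus-bond instance `Q_{x, x+e}` (definitionally). [cite: Scalapino1995, §2] -/
def singletPairOp (x y : Λ) : Matrix (Finset (Orb Λ)) (Finset (Orb Λ)) ℂ :=
  annihilation (orb x 0) * annihilation (orb y 1) - annihilation (orb x 1) * annihilation (orb y 0)

/-- The **`t`-`U`-`J` Hamiltonian** `hamiltonian G t U - (J/4) Σ_{x ∼ y ordered} Q_{xy}† Q_{xy}`:
the Hubbard Hamiltonian plus the antiferromagnetic (`J > 0`) superexchange of the `t`-`J` model,
`-(J/4) Σ_{ordered} Q†Q = -J Σ_{bonds} b†b = J Σ_{bonds} (S_x · S_y - n_x n_y / 4)` (the exchange term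
of [VojtaSachdev1999, eq. (1)] at `N = 1`, `V = 0`, added to `H(t, U)` instead of a no-double-occupancy
constraint; the route's `TUJSmallJ` model). [cite: VojtaSachdev1999, eq. (1)] -/
def tUJHamiltonian (t U J : ℝ) : Matrix (Finset (Orb Λ)) (Finset (Orb Λ)) ℂ :=
  hamiltonian G t U - ((J / 4 : ℝ) : ℂ) • ∑ x : Λ, ∑ y : Λ,
    if G.Adj x y then (singletPairOp x y)ᴴ * singletPairOp x y else 0

/-- A bond pair field with bond amplitudes `s`: `Σ_{x ∼ y ordered} s(x, y) B_{xy}` (flavour-singlet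
bond pairs weighted by a form factor, e.g. the `d_{x²-y²}` sign on the square lattice).
[cite: Scalapino1995, §2] -/
def flavourSignedBondField (n : ℕ) (s : Λ → Λ → ℂ) :
    Matrix (Finset (Orb (Λ ×ₗ Fin n))) (Finset (Orb (Λ ×ₗ Fin n))) ℂ :=
  ∑ x : Λ, ∑ y : Λ, if G.Adj x y then s x y • bondSingletPair n x y else 0

/-- The one-flavour bond pair field `Σ_{x ∼ y ordered} s(x, y) Q_{xy}`. [cite: Scalapino1995, §2] -/
def signedBondField (s : Λ → Λ → ℂ) : Matrix (Finset (Orb Λ)) (Finset (Orb Λ)) ℂ :=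
  ∑ x : Λ, ∑ y : Λ, if G.Adj x y then s x y • singletPairOp x y else 0

end General

/-! ### The models on the square torus `(ℤ/Lℤ)²` -/

section Torus

variable (n L : ℕ)

/-- The `Sp(2n)` pair-Hubbard Hamiltonian on the discrete torus `(ℤ/Lℤ)²`
(`spnPairHubbard (fermionTorusGraph 2 L) n t U J`). [cite: VojtaSachdev1999, eq. (1)] -/
def spnPairHubbardTorus (t U J : ℝ) :
    Matrix (Finset (Orb (FermionTorus 2 L ×ₗ Fin n))) (Finset (Orb (FermionTorus 2 L ×ₗ Fin n))) ℂ :=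
  spnPairHubbard (fermionTorusGraph 2 L) n t U J

/-- The `d_{x²-y²}` bond sign on the fermionic torus: `-1` if the sites `x`, `y` agree in the first
coordinate (a vertical bond), `+1` otherwise (a horizontal bond, when `x ∼ y`). [cite: Scalapino1995, §2, eq. (2.3)] -/
def spnDWaveBondSign (L : ℕ) (x y : FermionTorus 2 L) : ℂ := if (ofLex x) 0 = (ofLex y) 0 then -1 else 1

/-- The flavour-singlet `d_{x²-y²}` (`B₁g`) bond pair field on the torus,
`D = Σ_{x ∼ y ordered} g_d(x, y) B_{xy}` with `g_d = spnDWaveBondSign` (`-1` on vertical, `+1` on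
horizontal bonds). [cite: Scalapino1995, §2] -/
def flavourDWavePairField :
    Matrix (Finset (Orb (FermionTorus 2 L ×ₗ Fin n))) (Finset (Orb (FermionTorus 2 L ×ₗ Fin n))) ℂ :=
  flavourSignedBondField (fermionTorusGraph 2 L) n (spnDWaveBondSign L)

/-- The `t`-`U`-`J` Hamiltonian on the discrete torus `(ℤ/Lℤ)²`. [cite: VojtaSachdev1999, eq. (1)] -/
def tUJTorus (t U J : ℝ) :
    Matrix (Finset (Orb (FermionTorus 2 L))) (Finset (Orb (FermionTorus 2 L))) ℂ :=
  tUJHamiltonian (fermionTorusGraph 2 L) t U J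

/-- The one-flavour `d_{x²-y²}` bond pair field `Σ_{x ∼ y ordered} g_d(x, y) Q_{xy}` on the torus
(`= √2 Δ_d` for `L ≥ 3`, `dWaveBondField_eq_sqrt_two_smul_pairField`). [cite: Scalapino1995, §2] -/
def dWaveBondField : Matrix (Finset (Orb (FermionTorus 2 L))) (Finset (Orb (FermionTorus 2 L))) ℂ :=
  signedBondField (fermionTorusGraph 2 L) (spnDWaveBondSign L)

/-! ### Bridges to the inline expressions of route `SpNLargeN` -/

/-- `spnPairHubbardTorus n L 1 U J` is literally the Hamiltonian written inline (with
`c x m σ := annihilation (orb (toLex (x, m)) σ)`) in `SpnAnchorLRO` / `SpnMeanFieldLimit`. [folklore] -/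
theorem spnPairHubbardTorus_one_eq_inline (U J : ℝ) :
    spnPairHubbardTorus n L 1 U J =
      -(∑ x : FermionTorus 2 L, ∑ y : FermionTorus 2 L, ∑ m : Fin n, ∑ σ : Fin 2,
          if (fermionTorusGraph 2 L).Adj x y then
            (annihilation (orb (toLex (x, m)) σ))ᴴ * annihilation (orb (toLex (y, m)) σ) else 0) +
        ((U / n : ℝ) : ℂ) • (∑ x : FermionTorus 2 L,
          (∑ m : Fin n, annihilation (orb (toLex (x, m)) 1) * annihilation (orb (toLex (x, m)) 0))ᴴ *
            (∑ m : Fin n, annihilation (orb (toLex (x, m)) 1) * annihilation (orb (toLex (x, m)) 0))) -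
        ((J / (4 * n) : ℝ) : ℂ) • (∑ x : FermionTorus 2 L, ∑ y : FermionTorus 2 L,
          if (fermionTorusGraph 2 L).Adj x y then
            (∑ m : Fin n, (annihilation (orb (toLex (x, m)) 0) * annihilation (orb (toLex (y, m)) 1) -
                annihilation (orb (toLex (x, m)) 1) * annihilation (orb (toLex (y, m)) 0)))ᴴ *
              (∑ m : Fin n, (annihilation (orb (toLex (x, m)) 0) * annihilation (orb (toLex (y, m)) 1) -
                annihilation (orb (toLex (x, m)) 1) * annihilation (orb (toLex (y, m)) 0)))
          else 0) := by
  simp only [spnPairHubbardTorus, spnPairHubbard, flavourHopping, onSiteSingletPair, bondSingletPair,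
    flavourAnnihilation_eq, Complex.ofReal_one, neg_smul, one_smul]

/-- `flavourDWavePairField n L` is literally the pair field `D` written inline in `SpnAnchorLRO`. [folklore] -/
theorem flavourDWavePairField_eq_inline :
    flavourDWavePairField n L =
      ∑ x : FermionTorus 2 L, ∑ y : FermionTorus 2 L,
        if (fermionTorusGraph 2 L).Adj x y then
          (if (ofLex x) 0 = (ofLex y) 0 then (-1 : ℂ) else 1) •
            (∑ m : Fin n, (annihilation (orb (toLex (x, m)) 0) * annihilation (orb (toLex (y, m)) 1) -
              annihilation (orb (toLex (x, m)) 1) * annihilation (orb (toLex (y, m)) 0)))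
        else 0 := rfl

/-- `tUJTorus L t U J` is literally the `t`-`U`-`J` Hamiltonian written inline in `TUJSmallJ`,
`SuperexchangeDescent` and `SpnTarget`. [folklore] -/
theorem tUJTorus_eq_inline (t U J : ℝ) :
    tUJTorus L t U J =
      hubbardTorus 2 L t U - ((J / 4 : ℝ) : ℂ) • ∑ x : FermionTorus 2 L, ∑ y : FermionTorus 2 L,
        if (fermionTorusGraph 2 L).Adj x y then
          (annihilation (orb x 0) * annihilation (orb y 1) - annihilation (orb x 1) * annihilation (orb y 0))ᴴ *
            (annihilation (orb x 0) * annihilation (orb y 1) - annihilation (orb x 1) * annihilation (orb y 0))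
        else 0 := rfl

end Torus

/-! ### Hermiticity -/

section Hermitian

variable {Λ : Type*} [LinearOrder Λ] [Fintype Λ] (G : SimpleGraph Λ) [DecidableRel G.Adj]

/-- The hopping term is Hermitian: the sum over ordered adjacent pairs contains each term together
with its adjoint. [folklore] -/
theorem flavourHopping_isHermitian (n : ℕ) : (flavourHopping G n).IsHermitian := by
  unfold flavourHopping
  rw [IsHermitian]
  simp only [conjTranspose_sum]
  rw [Finset.sum_comm]
  refine Finset.sum_congr rfl fun x _ => Finset.sum_congr rfl fun y _ =>
    Finset.sum_congr rfl fun m _ => Finset.sum_congr rfl fun σ _ => ?_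
  by_cases h : G.Adj x y
  · rw [if_pos h, if_pos h.symm, conjTranspose_mul, conjTranspose_conjTranspose]
  · rw [if_neg h, if_neg (fun h' => h h'.symm), conjTranspose_zero]

omit [DecidableRel G.Adj] in
/-- A sum of `Aᴴ A` terms is Hermitian. [folklore] -/
private theorem isHermitian_sum_conjTranspose_mul_self {ι κ : Type*} [Fintype κ] (S : Finset ι)
    (A : ι → Matrix κ κ ℂ) : (∑ i ∈ S, (A i)ᴴ * A i).IsHermitian := by
  rw [IsHermitian, conjTranspose_sum]
  exact Finset.sum_congr rfl fun i _ => by rw [conjTranspose_mul, conjTranspose_conjTranspose]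

/-- **The `Sp(2n)` pair-Hubbard Hamiltonian is Hermitian** (real couplings; hopping over ordered
pairs; the interactions are sums of `A† A`). [cite: SachdevRead1991, §4] -/
theorem spnPairHubbard_isHermitian (n : ℕ) (t U J : ℝ) : (spnPairHubbard G n t U J).IsHermitian := by
  have h1 := flavourHopping_isHermitian G n
  have h2 : (∑ x : Λ, (onSiteSingletPair n x)ᴴ * onSiteSingletPair n x).IsHermitian :=
    isHermitian_sum_conjTranspose_mul_self _ _
  have h3 : (∑ x : Λ, ∑ y : Λ,
      if G.Adj x y then (bondSingletPair n x y)ᴴ * bondSingletPair n x y else 0).IsHermitian := by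
    rw [IsHermitian, conjTranspose_sum]
    refine Finset.sum_congr rfl fun x _ => ?_
    rw [conjTranspose_sum]
    refine Finset.sum_congr rfl fun y _ => ?_
    split_ifs
    · rw [conjTranspose_mul, conjTranspose_conjTranspose]
    · rw [conjTranspose_zero]
  unfold spnPairHubbard
  rw [IsHermitian, conjTranspose_sub, conjTranspose_add, conjTranspose_smul, conjTranspose_smul,
    conjTranspose_smul, h1.eq, h2.eq, h3.eq]
  simp only [Complex.star_def, map_neg, Complex.conj_ofReal]

/-- The `t`-`U`-`J` Hamiltonian is Hermitian. [folklore] -/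
theorem tUJHamiltonian_isHermitian (t U J : ℝ) : (tUJHamiltonian G t U J).IsHermitian := by
  have h1 : (hamiltonian G t U).IsHermitian := (hamiltonian_isHermitian_and_commute_holds G t U).1
  have h3 : (∑ x : Λ, ∑ y : Λ,
      if G.Adj x y then (singletPairOp x y)ᴴ * singletPairOp x y else 0).IsHermitian := by
    rw [IsHermitian, conjTranspose_sum]
    refine Finset.sum_congr rfl fun x _ => ?_
    rw [conjTranspose_sum]
    refine Finset.sum_congr rfl fun y _ => ?_
    split_ifs
    · rw [conjTranspose_mul, conjTranspose_conjTranspose]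
    · rw [conjTranspose_zero]
  unfold tUJHamiltonian
  rw [IsHermitian, conjTranspose_sub, conjTranspose_smul, h1.eq, h3.eq]
  simp only [Complex.star_def, Complex.conj_ofReal]

/-- The torus models are Hermitian. [folklore] -/
theorem spnPairHubbardTorus_isHermitian (n L : ℕ) (t U J : ℝ) :
    (spnPairHubbardTorus n L t U J).IsHermitian :=
  spnPairHubbard_isHermitian _ n t U J

/-- The torus `t`-`U`-`J` model is Hermitian. [folklore] -/
theorem tUJTorus_isHermitian (L : ℕ) (t U J : ℝ) : (tUJTorus L t U J).IsHermitian :=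
  tUJHamiltonian_isHermitian _ t U J

end Hermitian

/-! ### Conservation laws, I: matrices shifting an additive occupation weight

A matrix `M` on the Fock space `ℓ²(𝒫 ι)` *shifts the weight* `W : 𝒫 ι → ℂ` by `q` if its
nonzero entries `M s s'` only connect configurations with `W s = W s' + q` (for the additive weight
`W s = Σ_{i ∈ s} d_i` of the weighted number operator `Σ_i d_i n_i`: `[Σ d_i n_i, M] = q M`).
Shifts add under products, are negated by the adjoint, and weight-preserving matrices commute with
`Σ_i d_i n_i`; `c_i` shifts by `-d_i`. This is the bookkeeping behind "`H` conserves `N`, `S^z` and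
the flavour Cartan charges" below (generalising `PreservesSectors` of `HubbardLiebConfig`). -/

section WeightShift

variable {ι : Type*}

/-- `M` shifts the occupation weight `W` by `q`: `M s s' ≠ 0 → W s = W s' + q` (for the additive
weight of `Σ_i d_i n_i` this is `[Σ_i d_i n_i, M] = q M`). [folklore] -/
def HasWeightShift (W : Finset ι → ℂ) (q : ℂ) (M : Matrix (Finset ι) (Finset ι) ℂ) : Prop :=
  ∀ s s', M s s' ≠ 0 → W s = W s' + q

namespace HasWeightShift

variable {W : Finset ι → ℂ}

/-- `0` shifts every weight by anything. [folklore] -/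
theorem zero (q : ℂ) : HasWeightShift W q (0 : Matrix (Finset ι) (Finset ι) ℂ) :=
  fun _ _ h => absurd rfl h

/-- Transport of the shift along an equality of charges. [folklore] -/
theorem of_eq {q q' : ℂ} {M : Matrix (Finset ι) (Finset ι) ℂ} (hM : HasWeightShift W q M)
    (h : q = q') : HasWeightShift W q' M := h ▸ hM

/-- Sums of matrices with the same shift. [folklore] -/
theorem add {q : ℂ} {M N : Matrix (Finset ι) (Finset ι) ℂ} (hM : HasWeightShift W q M)
    (hN : HasWeightShift W q N) : HasWeightShift W q (M + N) := by
  intro s s' h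
  by_cases hMs : M s s' = 0
  · rw [Matrix.add_apply, hMs, zero_add] at h
    exact hN s s' h
  · exact hM s s' hMs

/-- Negation preserves the shift. [folklore] -/
theorem neg {q : ℂ} {M : Matrix (Finset ι) (Finset ι) ℂ} (hM : HasWeightShift W q M) :
    HasWeightShift W q (-M) :=
  fun s s' h => hM s s' fun h' => h (by rw [Matrix.neg_apply, h', neg_zero])

/-- Differences of matrices with the same shift. [folklore] -/
theorem sub {q : ℂ} {M N : Matrix (Finset ι) (Finset ι) ℂ} (hM : HasWeightShift W q M)
    (hN : HasWeightShift W q N) : HasWeightShift W q (M - N) := by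
  rw [sub_eq_add_neg]
  exact hM.add hN.neg

/-- Scalar multiples preserve the shift. [folklore] -/
theorem smul {q : ℂ} {M : Matrix (Finset ι) (Finset ι) ℂ} (hM : HasWeightShift W q M) (c : ℂ) :
    HasWeightShift W q (c • M) :=
  fun s s' h => hM s s' fun h' => h (by rw [Matrix.smul_apply, h', smul_zero])

/-- Finite sums of matrices with the same shift. [folklore] -/
theorem sum {κ : Type*} {S : Finset κ} {q : ℂ} {M : κ → Matrix (Finset ι) (Finset ι) ℂ}
    (hM : ∀ k ∈ S, HasWeightShift W q (M k)) : HasWeightShift W q (∑ k ∈ S, M k) := by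
  classical
  induction S using Finset.induction_on with
  | empty => rw [Finset.sum_empty]; exact zero q
  | @insert k S hk ih =>
    rw [Finset.sum_insert hk]
    exact (hM k (Finset.mem_insert_self k S)).add (ih fun j hj => hM j (Finset.mem_insert_of_mem hj))

/-- `if p then M else 0` has the shift of `M`. [folklore] -/
theorem ite {q : ℂ} {M : Matrix (Finset ι) (Finset ι) ℂ} (hM : HasWeightShift W q M)
    (p : Prop) [Decidable p] : HasWeightShift W q (if p then M else 0) := by
  split_ifs
  · exact hM
  · exact zero q

/-- The adjoint negates the shift. [folklore] -/
theorem conjTranspose {q : ℂ} {M : Matrix (Finset ι) (Finset ι) ℂ} (hM : HasWeightShift W q M) :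
    HasWeightShift W (-q) Mᴴ := by
  intro s s' h
  rw [conjTranspose_apply, star_ne_zero] at h
  rw [hM s' s h]
  ring

variable [Fintype ι]

/-- **Shifts add under products.** [folklore] -/
theorem mul {p q : ℂ} {M N : Matrix (Finset ι) (Finset ι) ℂ} (hM : HasWeightShift W p M)
    (hN : HasWeightShift W q N) : HasWeightShift W (p + q) (M * N) := by
  intro s s'' h
  rw [Matrix.mul_apply] at h
  obtain ⟨s', -, hs'⟩ := Finset.exists_ne_zero_of_sum_ne_zero h
  rw [hM s s' (left_ne_zero_of_mul hs'), hN s' s'' (right_ne_zero_of_mul hs')]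
  ring

variable [DecidableEq ι]

/-- **A weight-preserving matrix commutes with the diagonal matrix of the weight.** [folklore] -/
theorem commute_diagonal {M : Matrix (Finset ι) (Finset ι) ℂ} (hM : HasWeightShift W 0 M) :
    Commute M (diagonal W) := by
  rw [Commute, SemiconjBy]
  ext s s'
  rw [mul_diagonal, diagonal_mul]
  by_cases h : M s s' = 0
  · rw [h, mul_zero, zero_mul]
  · rw [hM s s' h, add_zero, mul_comm]

end HasWeightShift

variable [LinearOrder ι]

/-- `c_i` lowers the additive weight `Σ_{j ∈ s} d_j` by `d_i` (`[Σ d_j n_j, c_i] = -d_i c_i`). [folklore] -/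
theorem hasWeightShift_annihilation (d : ι → ℂ) (i : ι) :
    HasWeightShift (fun s => ∑ j ∈ s, d j) (-d i) (annihilation i) := by
  intro s s' h
  rw [annihilation_apply] at h
  split_ifs at h with hc
  · obtain ⟨hi, rfl⟩ := hc
    simp only
    rw [Finset.sum_insert hi]
    ring
  · exact absurd rfl h

/-- `c†_i` raises the additive weight `Σ_{j ∈ s} d_j` by `d_i` (`[Σ d_j n_j, c†_i] = d_i c†_i`). [folklore] -/
theorem hasWeightShift_creation (d : ι → ℂ) (i : ι) :
    HasWeightShift (fun s => ∑ j ∈ s, d j) (d i) (creation i) := by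
  have h := (hasWeightShift_annihilation d i).conjTranspose
  rwa [neg_neg, annihilation_conjTranspose] at h

variable [Fintype ι]

/-- The weighted number operator `Σ_i d_i n_i` (e.g. `N`, `S^z`, flavour charges). [cite: Tasaki2020, §9.2] -/
def weightedNumber (d : ι → ℂ) : Matrix (Finset ι) (Finset ι) ℂ := ∑ i, d i • numberAt i

/-- `Σ_i d_i n_i` is diagonal with entry `Σ_{i ∈ s} d_i` at the configuration `s`. [cite: Tasaki2020, §9.2] -/
theorem weightedNumber_eq_diagonal (d : ι → ℂ) :
    weightedNumber d = diagonal fun s => ∑ i ∈ s, d i := by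
  ext s t
  simp only [weightedNumber, Matrix.sum_apply, Matrix.smul_apply, numberAt_eq_diagonal, diagonal_apply,
    smul_eq_mul, mul_ite, mul_one, mul_zero]
  by_cases h : s = t
  · subst h
    simp only [if_true]
    rw [Finset.sum_ite_mem, Finset.univ_inter]
  · simp [h]

/-- **A weight-preserving matrix commutes with the weighted number operator.** [folklore] -/
theorem HasWeightShift.commute_weightedNumber {d : ι → ℂ} {M : Matrix (Finset ι) (Finset ι) ℂ}
    (hM : HasWeightShift (fun s => ∑ i ∈ s, d i) 0 M) : Commute M (weightedNumber d) := by
  rw [weightedNumber_eq_diagonal]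
  exact hM.commute_diagonal

/-- With unit weights the weighted number operator is the total number operator `N`. [folklore] -/
theorem weightedNumber_one : weightedNumber (fun _ : ι => (1 : ℂ)) = totalNumberOp := by
  simp [weightedNumber, totalNumberOp]

/-- On Hubbard orbitals `Orb Λ'`, `Σ_i d_i n_i = Σ_X Σ_σ d_{Xσ} n_{Xσ}`. [folklore] -/
theorem weightedNumber_orb {Λ' : Type*} [LinearOrder Λ'] [Fintype Λ'] (d : Orb Λ' → ℂ) :
    weightedNumber d = ∑ X : Λ', ∑ σ : Fin 2, d (orb X σ) • numberOp X σ := by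
  unfold weightedNumber
  rw [← Fintype.sum_prod_type', ← (toLex : Λ' × Fin 2 ≃ Orb Λ').sum_comp]
  rfl

/-- `S^z = Σ_i d_i n_i` with `d_{X↑} = ½`, `d_{X↓} = -½`. [folklore] -/
theorem spinZ_eq_weightedNumber {Λ' : Type*} [LinearOrder Λ'] [Fintype Λ'] :
    (spinZ : Matrix (Finset (Orb Λ')) (Finset (Orb Λ')) ℂ) =
      weightedNumber fun i => if (ofLex i).2 = 0 then (1 / 2 : ℂ) else -(1 / 2) := by
  rw [weightedNumber_orb]
  unfold spinZ
  rw [Finset.smul_sum]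
  refine Finset.sum_congr rfl fun X _ => ?_
  simp [Fin.sum_univ_two, sub_eq_add_neg]

/-- `N = Σ_i 1 · n_i` on Hubbard orbitals. [folklore] -/
theorem totalNumber_eq_weightedNumber {Λ' : Type*} [LinearOrder Λ'] [Fintype Λ'] :
    (totalNumber : Matrix (Finset (Orb Λ')) (Finset (Orb Λ')) ℂ) = weightedNumber fun _ => (1 : ℂ) := by
  rw [weightedNumber_one, totalNumberOp_eq_totalNumber]

end WeightShift

/-! ### Conservation laws, II: `N`, `S^z` and the Cartan torus of `Sp(2n)` -/

section Symmetry

variable {Λ : Type*} [LinearOrder Λ] [Fintype Λ]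

/-- The weights `d_{(x, m, σ)} = a + ε_σ b_m` (`ε_↑ = 1`, `ε_↓ = -1`) of the conserved charges
`a N + Σ_m b_m (N_{m↑} - N_{m↓})` of the `Sp(2n)` model. [cite: SachdevRead1991, §1] -/
def spnWeight {n : ℕ} (a : ℂ) (b : Fin n → ℂ) (i : Orb (Λ ×ₗ Fin n)) : ℂ :=
  a + if (ofLex i).2 = 0 then b (ofLex (ofLex i).1).2 else -b (ofLex (ofLex i).1).2

omit [LinearOrder Λ] [Fintype Λ] in
/-- The weight of the orbital `(x, m, σ)`. [folklore] -/
@[simp] theorem spnWeight_orb {n : ℕ} (a : ℂ) (b : Fin n → ℂ) (x : Λ) (m : Fin n) (σ : Fin 2) :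
    spnWeight a b (orb (toLex (x, m)) σ) = a + if σ = 0 then b m else -b m := rfl

/-- The flavour Cartan charge `C_m = N_{m↑} - N_{m↓} = Σ_x (n_{x m ↑} - n_{x m ↓})`, the generator of
the `m`-th `U(1)` of the maximal torus of `Sp(2n)` (`c_{xm↑} ↦ e^{iθ} c_{xm↑}`, `c_{xm↓} ↦ e^{-iθ} c_{xm↓}`).
[cite: SachdevRead1991, §1] -/
def flavourCartan (n : ℕ) (m : Fin n) : Matrix (Finset (Orb (Λ ×ₗ Fin n))) (Finset (Orb (Λ ×ₗ Fin n))) ℂ :=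
  ∑ x : Λ, (numberOp (toLex (x, m)) 0 - numberOp (toLex (x, m)) 1)

/-- The flavour-rotation generators `E_{mm'} = Σ_x (c†_{x m ↑} c_{x m' ↑} - c†_{x m' ↓} c_{x m ↓})` of the
subalgebra `𝔲(n) ⊂ 𝔰𝔭(2n)` (spin `↑` in the fundamental, spin `↓` in the conjugate representation of
`U(n)`, so that the singlet pairs `𝒥^{ab} c_a c_b` are invariant); `E_{mm} = C_m` (`flavourCartan`).
Together with `flavourSpinFlip` and its adjoints they span the second-quantised `𝔰𝔭(2n, ℂ)`
(`n² + n(n+1) = n(2n+1)` generators). [cite: SachdevRead1991, §1 (Uᵀ𝒥U = 𝒥)] -/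
def flavourRotation (n : ℕ) (m m' : Fin n) :
    Matrix (Finset (Orb (Λ ×ₗ Fin n))) (Finset (Orb (Λ ×ₗ Fin n))) ℂ :=
  ∑ x : Λ, ((flavourAnnihilation n x m 0)ᴴ * flavourAnnihilation n x m' 0 -
    (flavourAnnihilation n x m' 1)ᴴ * flavourAnnihilation n x m 1)

/-- The symmetric generators `F_{mm'} = Σ_x (c†_{x m ↑} c_{x m' ↓} + c†_{x m' ↑} c_{x m ↓})` of
`𝔰𝔭(2n, ℂ)` complementary to `𝔲(n)` (`F_{mm'} = F_{m'm}`; for `n = 1`, `F_{00} = 2 S⁺`).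
[cite: SachdevRead1991, §1 (Uᵀ𝒥U = 𝒥)] -/
def flavourSpinFlip (n : ℕ) (m m' : Fin n) :
    Matrix (Finset (Orb (Λ ×ₗ Fin n))) (Finset (Orb (Λ ×ₗ Fin n))) ℂ :=
  ∑ x : Λ, ((flavourAnnihilation n x m 0)ᴴ * flavourAnnihilation n x m' 1 +
    (flavourAnnihilation n x m' 0)ᴴ * flavourAnnihilation n x m 1)

/-- The diagonal flavour-rotation generators are the Cartan charges: `E_{mm} = C_m`. [folklore] -/
theorem flavourRotation_self (n : ℕ) (m : Fin n) :
    (flavourRotation n m m : Matrix (Finset (Orb (Λ ×ₗ Fin n))) _ ℂ) = flavourCartan n m := rfl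

section Shifts

variable {n : ℕ} (a : ℂ) (b : Fin n → ℂ)

omit [Fintype Λ] in
/-- `c_{x m σ}` lowers the weight by `d_{(x,m,σ)}`. [folklore] -/
theorem hasWeightShift_flavourAnnihilation (x : Λ) (m : Fin n) (σ : Fin 2) :
    HasWeightShift (fun s => ∑ j ∈ s, spnWeight a b j) (-(a + if σ = 0 then b m else -b m))
      (flavourAnnihilation n x m σ) := by
  have h := hasWeightShift_annihilation (spnWeight (Λ := Λ) a b) (orb (toLex (x, m)) σ)
  rwa [spnWeight_orb] at h

/-- `P_x` lowers the weight by `2a`. [folklore] -/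
theorem hasWeightShift_onSiteSingletPair (x : Λ) :
    HasWeightShift (fun s => ∑ j ∈ s, spnWeight a b j) (-(2 * a)) (onSiteSingletPair n x) := by
  unfold onSiteSingletPair
  refine HasWeightShift.sum fun m _ => ?_
  refine ((hasWeightShift_flavourAnnihilation a b x m 1).mul
    (hasWeightShift_flavourAnnihilation a b x m 0)).of_eq ?_
  simp only [Fin.isValue, one_ne_zero, if_false, if_true]
  ring

/-- `B_{xy}` lowers the weight by `2a`. [folklore] -/
theorem hasWeightShift_bondSingletPair (x y : Λ) :
    HasWeightShift (fun s => ∑ j ∈ s, spnWeight a b j) (-(2 * a)) (bondSingletPair n x y) := by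
  unfold bondSingletPair
  refine HasWeightShift.sum fun m _ => HasWeightShift.sub ?_ ?_
  · refine ((hasWeightShift_flavourAnnihilation a b x m 0).mul
      (hasWeightShift_flavourAnnihilation a b y m 1)).of_eq ?_
    simp only [Fin.isValue, one_ne_zero, if_false, if_true]
    ring
  · refine ((hasWeightShift_flavourAnnihilation a b x m 1).mul
      (hasWeightShift_flavourAnnihilation a b y m 0)).of_eq ?_
    simp only [Fin.isValue, one_ne_zero, if_false, if_true]
    ring

variable (G : SimpleGraph Λ) [DecidableRel G.Adj]

/-- The hopping term preserves the weight. [folklore] -/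
theorem hasWeightShift_flavourHopping :
    HasWeightShift (fun s => ∑ j ∈ s, spnWeight a b j) 0 (flavourHopping G n) := by
  unfold flavourHopping
  refine HasWeightShift.sum fun x _ => HasWeightShift.sum fun y _ => HasWeightShift.sum fun m _ =>
    HasWeightShift.sum fun σ _ => HasWeightShift.ite ?_ _
  refine ((hasWeightShift_flavourAnnihilation a b x m σ).conjTranspose.mul
    (hasWeightShift_flavourAnnihilation a b y m σ)).of_eq ?_
  ring

/-- **The `Sp(2n)` pair-Hubbard Hamiltonian preserves every weight `a N + Σ_m b_m C_m`.**
[cite: SachdevRead1991, §4] -/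
theorem hasWeightShift_spnPairHubbard (t U J : ℝ) :
    HasWeightShift (fun s => ∑ j ∈ s, spnWeight a b j) 0 (spnPairHubbard G n t U J) := by
  unfold spnPairHubbard
  refine HasWeightShift.sub (HasWeightShift.add ((hasWeightShift_flavourHopping a b G).smul _)
    (HasWeightShift.smul (HasWeightShift.sum fun x _ => ?_) _))
    (HasWeightShift.smul (HasWeightShift.sum fun x _ => HasWeightShift.sum fun y _ =>
      HasWeightShift.ite ?_ _) _)
  · exact ((hasWeightShift_onSiteSingletPair a b x).conjTranspose.mul
      (hasWeightShift_onSiteSingletPair a b x)).of_eq (by ring)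
  · exact ((hasWeightShift_bondSingletPair a b x y).conjTranspose.mul
      (hasWeightShift_bondSingletPair a b x y)).of_eq (by ring)

/-- `[H_n, a N + Σ_m b_m C_m] = 0` in weighted-number form. [cite: SachdevRead1991, §4] -/
theorem spnPairHubbard_commute_weightedNumber (t U J : ℝ) :
    Commute (spnPairHubbard G n t U J) (weightedNumber (spnWeight a b)) :=
  (hasWeightShift_spnPairHubbard a b G t U J).commute_weightedNumber

end Shifts

variable (G : SimpleGraph Λ) [DecidableRel G.Adj] (n : ℕ)

/-- **`[H_n, N] = 0`**: the `Sp(2n)` pair-Hubbard Hamiltonian conserves the particle number.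
[cite: SachdevRead1991, §4] -/
theorem spnPairHubbard_commute_totalNumber (t U J : ℝ) :
    Commute (spnPairHubbard G n t U J) totalNumber := by
  have h := spnPairHubbard_commute_weightedNumber (1 : ℂ) (fun _ : Fin n => (0 : ℂ)) G t U J
  rw [totalNumber_eq_weightedNumber]
  convert h using 2
  funext i
  simp [spnWeight]

/-- **`[H_n, S^z] = 0`**: the `Sp(2n)` pair-Hubbard Hamiltonian conserves the total spin
`S^z = ½ Σ_m C_m`. [cite: SachdevRead1991, §4] -/
theorem spnPairHubbard_commute_spinZ (t U J : ℝ) :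
    Commute (spnPairHubbard G n t U J) spinZ := by
  have h := spnPairHubbard_commute_weightedNumber (0 : ℂ) (fun _ : Fin n => (1 / 2 : ℂ)) G t U J
  rw [spinZ_eq_weightedNumber]
  convert h using 2
  funext i
  simp [spnWeight]

/-- The Cartan charge as a weighted number operator. [folklore] -/
theorem flavourCartan_eq_weightedNumber (m : Fin n) :
    (flavourCartan n m : Matrix (Finset (Orb (Λ ×ₗ Fin n))) _ ℂ) =
      weightedNumber (spnWeight 0 fun m' => if m' = m then 1 else 0) := by
  rw [weightedNumber_orb, ← (toLex : Λ × Fin n ≃ Λ ×ₗ Fin n).sum_comp (fun X => ∑ σ : Fin 2,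
      spnWeight (0 : ℂ) (fun m' => if m' = m then (1 : ℂ) else 0) (orb X σ) • numberOp X σ),
    Fintype.sum_prod_type]
  unfold flavourCartan
  refine Finset.sum_congr rfl fun x _ => ?_
  simp only [spnWeight_orb, Fin.sum_univ_two, Fin.isValue, if_true, one_ne_zero, if_false, zero_add]
  rw [Finset.sum_eq_single m]
  · simp [sub_eq_add_neg]
  · intro m' _ hm'
    simp [hm']
  · intro h
    exact absurd (Finset.mem_univ m) h

/-- **Invariance under the Cartan torus `U(1)^n ⊂ Sp(2n)`**: `[H_n, N_{m↑} - N_{m↓}] = 0` for every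
flavour `m`. [cite: SachdevRead1991, §4] -/
theorem spnPairHubbard_commute_flavourCartan (t U J : ℝ) (m : Fin n) :
    Commute (spnPairHubbard G n t U J) (flavourCartan n m) := by
  rw [flavourCartan_eq_weightedNumber]
  exact spnPairHubbard_commute_weightedNumber _ _ G t U J

/-- The torus model conserves `N` and `S^z` (so it is block diagonal in the sectors `szSector`).
[cite: SachdevRead1991, §4] -/
theorem spnPairHubbardTorus_commute (n L : ℕ) (t U J : ℝ) :
    Commute (spnPairHubbardTorus n L t U J) totalNumber ∧ Commute (spnPairHubbardTorus n L t U J) spinZ :=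
  ⟨spnPairHubbard_commute_totalNumber _ n t U J, spnPairHubbard_commute_spinZ _ n t U J⟩

end Symmetry


/-! ### Transport along order isomorphisms of orbital sets

For an order isomorphism `e : ι ≃o ι'` the environment of `FermionEmbedding.jwEmbed e` is empty, so
`jwEmbed e` is the reindexing of matrices by `s ↦ e(s)` (`jwEmbed_orderIso_eq_reindex`) and is
implemented by the unitary `fockCongr e : ψ ↦ ψ ∘ e⁻¹` of Fock spaces: `jwEmbed e A (Uψ) = U(Aψ)`,
`⟨Uψ, Uφ⟩ = ⟨ψ, φ⟩`, `⟨jwEmbed e A⟩_{Uψ} = ⟨A⟩_ψ`; particle numbers, `(N, S^z)`-sectors, sector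
energies and sector ground states correspond (Bratteli–Robinson II §5.2.2: Bogoliubov
transformations induced by unitaries of the one-particle space, here a relabelling of orbitals). -/

section IsoTransport

variable {ι ι' : Type*} [LinearOrder ι] [LinearOrder ι']

/-- `jwEmbed` is `ℂ`-linear (restated from `JWEmbed.embedFun_smul`; the generic `map_smul` needs an
instance search that times out on large orbital types). [folklore] -/
theorem jwEmbed_smul [Fintype ι] [Fintype ι'] (e : ι ↪o ι') (c : ℂ) (a : Matrix (Finset ι) (Finset ι) ℂ) :
    jwEmbed e (c • a) = c • jwEmbed e a :=
  JWEmbed.embedFun_smul c a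

/-- `jwEmbed` is multiplicative (restated from `JWEmbed.embedFun_mul`, same reason). [folklore] -/
theorem jwEmbed_mul [Fintype ι] [Fintype ι'] (e : ι ↪o ι') (a b : Matrix (Finset ι) (Finset ι) ℂ) :
    jwEmbed e (a * b) = jwEmbed e a * jwEmbed e b :=
  JWEmbed.embedFun_mul a b

/-- The unitary `U_e : ψ ↦ ψ ∘ e⁻¹` between the Fock spaces of order-isomorphic orbital sets
(`(fockCongr e ψ) s' = ψ (e⁻¹ s')`). [cite: BratteliRobinsonII1997, §5.2.2 (Bogoliubov transformations)] -/
def fockCongr (e : ι ≃o ι') : Fock ι ≃ₗ[ℂ] Fock ι' :=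
  LinearEquiv.funCongrLeft ℂ ℂ (Equiv.finsetCongr e.toEquiv).symm

/-- `fockCongr e ψ = ψ ∘ e⁻¹` on configurations. [folklore] -/
theorem fockCongr_eq_comp (e : ι ≃o ι') (ψ : Fock ι) :
    (fockCongr e ψ : Fock ι') = ψ ∘ (Equiv.finsetCongr e.toEquiv).symm := rfl

/-- `fockCongr` evaluated at a configuration. [folklore] -/
theorem fockCongr_apply (e : ι ≃o ι') (ψ : Fock ι) (s' : Finset ι') :
    fockCongr e ψ s' = ψ ((Equiv.finsetCongr e.toEquiv).symm s') := rfl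

omit [LinearOrder ι] [LinearOrder ι'] in
/-- Relabelling a configuration preserves its cardinality. [folklore] -/
theorem card_finsetCongr (f : ι ≃ ι') (s : Finset ι) : (Equiv.finsetCongr f s).card = s.card := by
  rw [Equiv.finsetCongr_apply, Finset.card_map]

/-- `fockCongr` preserves inner products (it is unitary). [cite: BratteliRobinsonII1997, §5.2.2] -/
theorem star_fockCongr_dotProduct [Fintype ι] [Fintype ι'] (e : ι ≃o ι') (ψ φ : Fock ι) :
    star (fockCongr e ψ) ⬝ᵥ fockCongr e φ = star ψ ⬝ᵥ φ := by
  rw [fockCongr_eq_comp, fockCongr_eq_comp]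
  exact comp_equiv_dotProduct_comp_equiv (star ψ) φ (Equiv.finsetCongr e.toEquiv).symm

/-- `fockCongr` preserves the `N`-particle sectors. [folklore] -/
theorem isNParticle_fockCongr_iff (e : ι ≃o ι') (N : ℕ) (ψ : Fock ι) :
    IsNParticle N (fockCongr e ψ) ↔ IsNParticle N ψ := by
  constructor
  · intro h s hs
    have h' := h (Equiv.finsetCongr e.toEquiv s) (by rwa [card_finsetCongr])
    rwa [fockCongr_apply, Equiv.symm_apply_apply] at h'
  · intro h s' hs'
    rw [fockCongr_apply]
    refine h _ ?_
    rwa [Equiv.finsetCongr_symm, card_finsetCongr]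

variable [Fintype ι] [Fintype ι']

namespace JWEmbed

omit [Fintype ι'] in
/-- Along an order isomorphism the environment is empty. [folklore] -/
theorem env_orderIso (e : ι ≃o ι') (u' : Finset ι') : env e.toOrderEmbedding u' = ∅ := by
  ext j
  simp only [mem_env, Finset.notMem_empty, iff_false, not_and, not_not]
  exact fun _ => mem_rangeF.2 ⟨e.symm j, by simp⟩

omit [Fintype ι] [Fintype ι'] in
/-- Along an order isomorphism the image part is the preimage configuration. [folklore] -/
theorem pre_orderIso (e : ι ≃o ι') (u' : Finset ι') :
    pre e.toOrderEmbedding u' = (Equiv.finsetCongr e.toEquiv).symm u' := by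
  ext i
  rw [mem_pre, Equiv.finsetCongr_symm, Equiv.finsetCongr_apply, Finset.mem_map_equiv, Equiv.symm_symm]
  rfl

omit [Fintype ι] [Fintype ι'] in
/-- With an empty environment all environment signs are `+1`. [folklore] -/
theorem transSign_empty_env (e : ι ↪o ι') (X : Finset ι) : transSign e ∅ X = 1 :=
  Finset.prod_eq_one fun i _ => by simp [envSign]

end JWEmbed

/-- **Along an order isomorphism, `jwEmbed` is the reindexing `s ↦ e(s)` of matrices** (no
Jordan–Wigner signs: the environment is empty). [cite: BratteliRobinsonII1997, §5.2.2, Thm. 5.2.5] -/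
theorem jwEmbed_orderIso_eq_reindex (e : ι ≃o ι') (a : Matrix (Finset ι) (Finset ι) ℂ) :
    jwEmbed e.toOrderEmbedding a =
      Matrix.reindex (Equiv.finsetCongr e.toEquiv) (Equiv.finsetCongr e.toEquiv) a := by
  ext u' v'
  rw [jwEmbed_apply, JWEmbed.embedFun_apply, JWEmbed.env_orderIso, JWEmbed.env_orderIso, if_pos rfl,
    JWEmbed.transSign_empty_env, mul_one, JWEmbed.pre_orderIso, JWEmbed.pre_orderIso, Matrix.reindex_apply,
    Matrix.submatrix_apply]

/-- **`jwEmbed e A (U_e ψ) = U_e (A ψ)`**: the unitary `fockCongr e` implements `jwEmbed e`.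
[cite: BratteliRobinsonII1997, §5.2.2 (unitarily implemented Bogoliubov transformations)] -/
theorem jwEmbed_mulVec_fockCongr (e : ι ≃o ι') (A : Matrix (Finset ι) (Finset ι) ℂ) (ψ : Fock ι) :
    jwEmbed e.toOrderEmbedding A *ᵥ fockCongr e ψ = fockCongr e (A *ᵥ ψ) := by
  rw [jwEmbed_orderIso_eq_reindex, Matrix.reindex_apply, fockCongr_eq_comp, fockCongr_eq_comp,
    Matrix.submatrix_mulVec_equiv, Equiv.symm_symm, Function.comp_assoc, Equiv.symm_comp_self,
    Function.comp_id]

/-- **Expectations correspond**: `⟨U_e ψ, jwEmbed e A U_e ψ⟩ = ⟨ψ, A ψ⟩`. [cite: BratteliRobinsonII1997, §5.2.2] -/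
theorem expect_jwEmbed_fockCongr (e : ι ≃o ι') (A : Matrix (Finset ι) (Finset ι) ℂ) (ψ : Fock ι) :
    expect (jwEmbed e.toOrderEmbedding A) (fockCongr e ψ) = expect A ψ := by
  rw [expect, expect, jwEmbed_mulVec_fockCongr, star_fockCongr_dotProduct]

end IsoTransport

section OrbIso

variable {Λ Λ' : Type*} [LinearOrder Λ] [LinearOrder Λ']

/-- The orbital order isomorphism `(x, σ) ↦ (e₀ x, σ)` induced by an order isomorphism of site
sets (the isomorphism version of `orbEmb`). [folklore] -/
def orbIso (e₀ : Λ ≃o Λ') : Orb Λ ≃o Orb Λ' where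
  toFun i := orb (e₀ (ofLex i).1) (ofLex i).2
  invFun j := orb (e₀.symm (ofLex j).1) (ofLex j).2
  left_inv i := by
    show orb (e₀.symm (e₀ (ofLex i).1)) (ofLex i).2 = i
    rw [OrderIso.symm_apply_apply]
    rfl
  right_inv j := by
    show orb (e₀ (e₀.symm (ofLex j).1)) (ofLex j).2 = j
    rw [OrderIso.apply_symm_apply]
    rfl
  map_rel_iff' := (orbEmb e₀.toOrderEmbedding).map_rel_iff

/-- `orbIso` on an orbital. [folklore] -/
@[simp] theorem orbIso_orb (e₀ : Λ ≃o Λ') (x : Λ) (σ : Fin 2) : orbIso e₀ (orb x σ) = orb (e₀ x) σ := rfl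

/-- `orbIso` as an order embedding, on an orbital. [folklore] -/
@[simp] theorem orbIso_toOrderEmbedding_orb (e₀ : Λ ≃o Λ') (x : Λ) (σ : Fin 2) :
    (orbIso e₀).toOrderEmbedding (orb x σ) = orb (e₀ x) σ := rfl

variable [Fintype Λ] [Fintype Λ'] (e₀ : Λ ≃o Λ')

/-- `n_{xσ} ↦ n_{(e₀ x)σ}`. [cite: BratteliRobinsonII1997, §5.2.2 (isotony)] -/
theorem jwEmbed_orbIso_numberOp (x : Λ) (σ : Fin 2) :
    jwEmbed (orbIso e₀).toOrderEmbedding (numberOp x σ) = numberOp (e₀ x) σ := by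
  rw [numberOp, map_mul, jwEmbed_creation, jwEmbed_annihilation, orbIso_toOrderEmbedding_orb, numberOp]

/-- The total number operator is transported to the total number operator. [folklore] -/
theorem jwEmbed_orbIso_totalNumber :
    jwEmbed (orbIso e₀).toOrderEmbedding (totalNumber : Matrix (Finset (Orb Λ)) _ ℂ) = totalNumber := by
  unfold totalNumber
  rw [map_sum]
  simp_rw [map_sum, jwEmbed_orbIso_numberOp]
  exact e₀.toEquiv.sum_comp (fun x' => ∑ σ : Fin 2, (numberOp x' σ : Matrix (Finset (Orb Λ')) _ ℂ))

/-- `S^z` is transported to `S^z`. [folklore] -/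
theorem jwEmbed_orbIso_spinZ :
    jwEmbed (orbIso e₀).toOrderEmbedding (spinZ : Matrix (Finset (Orb Λ)) _ ℂ) = spinZ := by
  unfold spinZ
  rw [jwEmbed_smul, map_sum]
  simp_rw [map_sub, jwEmbed_orbIso_numberOp]
  congr 1
  exact e₀.toEquiv.sum_comp (fun x' => (numberOp x' 0 - numberOp x' 1 : Matrix (Finset (Orb Λ')) _ ℂ))

/-- **Sectors correspond**: `U ψ ∈ szSector N M ↔ ψ ∈ szSector N M`. [folklore] -/
theorem fockCongr_mem_szSector_iff (N : ℕ) (M : ℝ) (ψ : Fock (Orb Λ)) :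
    fockCongr (orbIso e₀) ψ ∈ szSector N M ↔ ψ ∈ szSector N M := by
  rw [mem_szSector_iff, mem_szSector_iff, isNParticle_fockCongr_iff]
  refine and_congr_right fun _ => ?_
  rw [← jwEmbed_orbIso_spinZ e₀, jwEmbed_mulVec_fockCongr, ← LinearEquiv.map_smul,
    (fockCongr (orbIso e₀)).injective.eq_iff]

/-- **Sector energies correspond**: `minEnergyOn (jwEmbed H) (szSector N M) = minEnergyOn H (szSector N M)`.
[folklore] -/
theorem minEnergyOn_jwEmbed_orbIso (H : Matrix (Finset (Orb Λ)) (Finset (Orb Λ)) ℂ) (N : ℕ) (M : ℝ) :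
    (jwEmbed (orbIso e₀).toOrderEmbedding H).minEnergyOn (szSector N M) = H.minEnergyOn (szSector N M) := by
  unfold Matrix.minEnergyOn
  congr 1
  ext E
  constructor
  · rintro ⟨ψ', hmem, hnorm, rfl⟩
    obtain ⟨ψ, rfl⟩ := (fockCongr (orbIso e₀)).surjective ψ'
    refine ⟨ψ, (fockCongr_mem_szSector_iff e₀ N M ψ).1 hmem, by rwa [star_fockCongr_dotProduct] at hnorm, ?_⟩
    rw [jwEmbed_mulVec_fockCongr, star_fockCongr_dotProduct]
  · rintro ⟨ψ, hmem, hnorm, rfl⟩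
    refine ⟨fockCongr (orbIso e₀) ψ, (fockCongr_mem_szSector_iff e₀ N M ψ).2 hmem,
      by rwa [star_fockCongr_dotProduct], ?_⟩
    rw [jwEmbed_mulVec_fockCongr, star_fockCongr_dotProduct]

/-- **Sector ground states correspond**: `U ψ` is a ground state of `jwEmbed H` in the sector
`(N, S^z = M)` iff `ψ` is one of `H`. [folklore] -/
theorem isGroundStateInSector_fockCongr_iff (H : Matrix (Finset (Orb Λ)) (Finset (Orb Λ)) ℂ) (N : ℕ) (M : ℝ)
    (ψ : Fock (Orb Λ)) :
    IsGroundStateInSector (jwEmbed (orbIso e₀).toOrderEmbedding H) N M (fockCongr (orbIso e₀) ψ) ↔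
      IsGroundStateInSector H N M ψ := by
  unfold IsGroundStateInSector
  rw [fockCongr_mem_szSector_iff, minEnergyOn_jwEmbed_orbIso, jwEmbed_mulVec_fockCongr, ← LinearEquiv.map_smul,
    (fockCongr (orbIso e₀)).injective.eq_iff, (fockCongr (orbIso e₀)).map_ne_zero_iff]

end OrbIso

/-! ### The `n = 1` reduction: one flavour is the `t`-`U`-`J` model -/

section Reduction

variable {Λ : Type*} [LinearOrder Λ] [Fintype Λ]

/-- The orbital order isomorphism `((x, 0), σ) ↦ (x, σ)` : `Orb (Λ ×ₗ Fin 1) ≃o Orb Λ` along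
`Λ ×ₗ Fin 1 ≃o Λ` (`Prod.Lex.prodUnique`). [cite: BratteliRobinsonII1997, §5.2.2 (isotony of the CAR algebras)] -/
def oneFlavourOrbIso (Λ : Type*) [LinearOrder Λ] : Orb (Λ ×ₗ Fin 1) ≃o Orb Λ :=
  orbIso (Prod.Lex.prodUnique Λ (Fin 1))

/-- The orbital order embedding `((x, 0), σ) ↦ (x, σ)` (the order isomorphism `oneFlavourOrbIso`
as an embedding, the argument of `jwEmbed`). [cite: BratteliRobinsonII1997, §5.2.2] -/
abbrev oneFlavourOrbEmb (Λ : Type*) [LinearOrder Λ] : Orb (Λ ×ₗ Fin 1) ↪o Orb Λ :=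
  (oneFlavourOrbIso Λ).toOrderEmbedding

omit [Fintype Λ] in
/-- `oneFlavourOrbEmb` on an orbital. [folklore] -/
@[simp] theorem oneFlavourOrbEmb_orb (x : Λ) (m : Fin 1) (σ : Fin 2) :
    oneFlavourOrbEmb Λ (orb (toLex (x, m)) σ) = orb x σ := rfl

omit [Fintype Λ] in
/-- `oneFlavourOrbEmb` is surjective (it comes from an order isomorphism). [folklore] -/
theorem oneFlavourOrbEmb_surjective : Function.Surjective (oneFlavourOrbEmb Λ) :=
  (oneFlavourOrbIso Λ).surjective

/-- `c_{x 0 σ} ↦ c_{x σ}`. [cite: BratteliRobinsonII1997, §5.2.2, eq. (5.2.13)] -/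
@[simp] theorem jwEmbed_one_flavourAnnihilation (x : Λ) (m : Fin 1) (σ : Fin 2) :
    jwEmbed (oneFlavourOrbEmb Λ) (flavourAnnihilation 1 x m σ) = annihilation (orb x σ) := by
  rw [flavourAnnihilation_eq, jwEmbed_annihilation, oneFlavourOrbEmb_orb]

/-- `P_x ↦ c_{x↓} c_{x↑}`. [folklore] -/
@[simp] theorem jwEmbed_one_onSiteSingletPair (x : Λ) :
    jwEmbed (oneFlavourOrbEmb Λ) (onSiteSingletPair 1 x) = annihilation (orb x 1) * annihilation (orb x 0) := by
  simp [onSiteSingletPair]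

/-- `B_{xy} ↦ Q_{xy}`. [folklore] -/
@[simp] theorem jwEmbed_one_bondSingletPair (x y : Λ) :
    jwEmbed (oneFlavourOrbEmb Λ) (bondSingletPair 1 x y) = singletPairOp x y := by
  simp [bondSingletPair, singletPairOp]

variable (G : SimpleGraph Λ) [DecidableRel G.Adj]

/-- The one-flavour hopping term is the Hubbard hopping term. [folklore] -/
theorem jwEmbed_one_flavourHopping :
    jwEmbed (oneFlavourOrbEmb Λ) (flavourHopping G 1) =
      ∑ x : Λ, ∑ y : Λ, ∑ σ : Fin 2, if G.Adj x y then creation (orb x σ) * annihilation (orb y σ) else 0 := by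
  simp only [flavourHopping, map_sum, Fin.sum_univ_one, apply_ite (jwEmbed (oneFlavourOrbEmb Λ)), map_zero,
    map_mul, jwEmbed_conjTranspose, jwEmbed_one_flavourAnnihilation, annihilation_conjTranspose]

/-- A signed flavour bond field at one flavour is the signed bond field. [folklore] -/
theorem jwEmbed_one_flavourSignedBondField (s : Λ → Λ → ℂ) :
    jwEmbed (oneFlavourOrbEmb Λ) (flavourSignedBondField G 1 s) = signedBondField G s := by
  simp only [flavourSignedBondField, signedBondField, map_sum, apply_ite (jwEmbed (oneFlavourOrbEmb Λ)),
    map_zero, jwEmbed_smul, jwEmbed_one_bondSingletPair]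

omit [LinearOrder Λ] [Fintype Λ] in
/-- The two spin orbitals of a site differ. [folklore] -/
private theorem orb_spinUp_ne_spinDown (x : Λ) : orb x 0 ≠ orb x 1 := by
  simp

/-- At one flavour the pair repulsion is the Hubbard interaction:
`(c_{x↓} c_{x↑})† (c_{x↓} c_{x↑}) = n_{x↑} n_{x↓}`. [cite: Tasaki2020, §9.3] -/
theorem conjTranspose_onSitePair_mul_self (x : Λ) :
    (annihilation (orb x 1) * annihilation (orb x 0))ᴴ * (annihilation (orb x 1) * annihilation (orb x 0)) =
      (numberOp x 0 * numberOp x 1 : Matrix (Finset (Orb Λ)) (Finset (Orb Λ)) ℂ) := by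
  rw [conjTranspose_mul, annihilation_conjTranspose, annihilation_conjTranspose,
    creation_mul_creation_eq_neg (orb x 0) (orb x 1),
    LiebThm1.annihilation_mul_annihilation_eq_neg (orb x 1) (orb x 0), neg_mul_neg, numberOp, numberOp,
    ← mul_assoc (creation (orb x 0) * annihilation (orb x 0)), number_mul_creation_of_ne (orb_spinUp_ne_spinDown x)]
  simp only [mul_assoc]

/-- **The `n = 1` reduction.** Second quantisation of the order isomorphism `Λ ×ₗ Fin 1 ≃o Λ`
carries the one-flavour `Sp(2)` pair-Hubbard Hamiltonian to the `t`-`U`-`J` Hamiltonian: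
`jwEmbed (spnPairHubbard G 1 t U J) = hamiltonian G t U - (J/4) Σ_{x∼y} Q_{xy}† Q_{xy}`
(`Sp(2) ≅ SU(2)`; `(U/1) P_x†P_x = U n_{x↑}n_{x↓}`). [cite: SachdevRead1991, §4 (N = 1 is the physical t-J model)] -/
theorem jwEmbed_spnPairHubbard_one (t U J : ℝ) :
    jwEmbed (oneFlavourOrbEmb Λ) (spnPairHubbard G 1 t U J) = tUJHamiltonian G t U J := by
  have hP : jwEmbed (oneFlavourOrbEmb Λ) (∑ x : Λ, (onSiteSingletPair 1 x)ᴴ * onSiteSingletPair 1 x) =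
      ∑ x : Λ, numberOp x 0 * numberOp x 1 := by
    rw [map_sum]
    refine Finset.sum_congr rfl fun x _ => ?_
    rw [map_mul, jwEmbed_conjTranspose, jwEmbed_one_onSiteSingletPair, conjTranspose_onSitePair_mul_self]
  have hB : jwEmbed (oneFlavourOrbEmb Λ) (∑ x : Λ, ∑ y : Λ,
      if G.Adj x y then (bondSingletPair 1 x y)ᴴ * bondSingletPair 1 x y else 0) =
      ∑ x : Λ, ∑ y : Λ, if G.Adj x y then (singletPairOp x y)ᴴ * singletPairOp x y else 0 := by
    rw [map_sum]
    refine Finset.sum_congr rfl fun x _ => ?_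
    rw [map_sum]
    refine Finset.sum_congr rfl fun y _ => ?_
    split_ifs
    · rw [map_mul, jwEmbed_conjTranspose, jwEmbed_one_bondSingletPair]
    · rw [map_zero]
  rw [spnPairHubbard, map_sub, map_add, jwEmbed_smul, jwEmbed_smul, jwEmbed_smul, jwEmbed_one_flavourHopping,
    hP, hB, tUJHamiltonian, hamiltonian, Nat.cast_one, div_one, mul_one]

/-- The `n = 1` reduction on the torus: `spnPairHubbardTorus 1 L t U J ↦ tUJTorus L t U J`. [folklore] -/
theorem jwEmbed_spnPairHubbardTorus_one (L : ℕ) (t U J : ℝ) :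
    jwEmbed (oneFlavourOrbEmb (FermionTorus 2 L)) (spnPairHubbardTorus 1 L t U J) = tUJTorus L t U J :=
  jwEmbed_spnPairHubbard_one _ t U J

/-- The `n = 1` reduction of the flavour `d`-wave bond field: `flavourDWavePairField 1 L ↦ dWaveBondField L`.
[folklore] -/
theorem jwEmbed_flavourDWavePairField_one (L : ℕ) :
    jwEmbed (oneFlavourOrbEmb (FermionTorus 2 L)) (flavourDWavePairField 1 L) = dWaveBondField L :=
  jwEmbed_one_flavourSignedBondField _ _

/-- The `n = 1` objects also conserve `N` and `S^z`: `[H_{tUJ}, N] = [H_{tUJ}, S^z] = 0`. [folklore] -/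
theorem tUJHamiltonian_commute (t U J : ℝ) :
    Commute (tUJHamiltonian G t U J) totalNumber ∧ Commute (tUJHamiltonian G t U J) spinZ := by
  have hH := hamiltonian_isHermitian_and_commute_holds G t U
  -- the superexchange term preserves every weight `a N + b (N↑ - N↓)`
  have hQ : ∀ (a b : ℂ), HasWeightShift
      (fun s => ∑ j ∈ s, (fun i : Orb Λ => a + if (ofLex i).2 = 0 then b else -b) j) 0
      (∑ x : Λ, ∑ y : Λ, if G.Adj x y then (singletPairOp x y)ᴴ * singletPairOp x y else 0) := by
    intro a b
    have hc : ∀ (z : Λ) (σ : Fin 2), HasWeightShift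
        (fun s => ∑ j ∈ s, (fun i : Orb Λ => a + if (ofLex i).2 = 0 then b else -b) j)
        (-(a + if σ = 0 then b else -b)) (annihilation (orb z σ)) := fun z σ =>
      hasWeightShift_annihilation (fun i : Orb Λ => a + if (ofLex i).2 = 0 then b else -b) (orb z σ)
    have hB : ∀ x y : Λ, HasWeightShift
        (fun s => ∑ j ∈ s, (fun i : Orb Λ => a + if (ofLex i).2 = 0 then b else -b) j)
        (-(2 * a)) (singletPairOp x y) := by
      intro x y
      refine HasWeightShift.sub (((hc x 0).mul (hc y 1)).of_eq ?_) (((hc x 1).mul (hc y 0)).of_eq ?_)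
      · simp only [Fin.isValue, if_true, one_ne_zero, if_false]; ring
      · simp only [Fin.isValue, if_true, one_ne_zero, if_false]; ring
    refine HasWeightShift.sum fun x _ => HasWeightShift.sum fun y _ => HasWeightShift.ite ?_ _
    exact ((hB x y).conjTranspose.mul (hB x y)).of_eq (by ring)
  have hw1 : (fun _ : Orb Λ => (1 : ℂ)) = fun i : Orb Λ => (1 : ℂ) + if (ofLex i).2 = 0 then 0 else -0 := by
    funext i; simp
  have hw2 : (fun i : Orb Λ => if (ofLex i).2 = 0 then (1 / 2 : ℂ) else -(1 / 2)) =
      fun i : Orb Λ => (0 : ℂ) + if (ofLex i).2 = 0 then (1 / 2 : ℂ) else -(1 / 2) := by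
    funext i; simp
  constructor
  · refine Commute.sub_left hH.2.1 (Commute.smul_left ?_ _)
    rw [totalNumber_eq_weightedNumber, hw1]
    exact (hQ 1 0).commute_weightedNumber
  · refine Commute.sub_left hH.2.2 (Commute.smul_left ?_ _)
    rw [spinZ_eq_weightedNumber, hw2]
    exact (hQ 0 (1 / 2)).commute_weightedNumber

/-- The torus `t`-`U`-`J` model conserves `N` and `S^z`. [folklore] -/
theorem tUJTorus_commute (L : ℕ) (t U J : ℝ) :
    Commute (tUJTorus L t U J) totalNumber ∧ Commute (tUJTorus L t U J) spinZ :=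
  tUJHamiltonian_commute _ t U J

end Reduction

/-! ### The one-flavour `d`-wave bond field is `√2 Δ_d` on the square torus (`L ≥ 3`)

On `(ℤ/Lℤ)²` with `L ≥ 3` the four unit steps `±e₁, ±e₂` from a site lead to four distinct
neighbours and exhaust them (`torusGraph_adj_iff`), the bond sign `spnDWaveBondSign` of the step `±e₁`
(`±e₂`) is `+1` (`-1`) `= g_d(±e₁)` (`g_d(±e₂)`), and `pairField g L = Σ_x Σ_e (g e/√2) Q_{x,x+e}`;
hence `Σ_{x∼y} g_d Q_{xy} = √2 Δ_d`. At `L = 2` the torus graph is simple while the step sum counts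
each neighbour twice, so the identity fails by a factor. -/

section DWave

open Literature.Probability.LatticeModels

variable {L : ℕ}

/-- `1 ≠ 0` in `ZMod L` for `L ≥ 2`. [folklore] -/
private theorem zmod_one_ne_zero (hL : 2 ≤ L) : (1 : ZMod L) ≠ 0 := by
  intro h
  have h' : ((1 : ℕ) : ZMod L) = 0 := by rw [Nat.cast_one, h]
  rw [ZMod.natCast_eq_zero_iff] at h'
  have := Nat.le_of_dvd one_pos h'
  omega

/-- `-1 ≠ 0` in `ZMod L` for `L ≥ 2`. [folklore] -/
private theorem zmod_neg_one_ne_zero (hL : 2 ≤ L) : (-1 : ZMod L) ≠ 0 :=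
  fun h => zmod_one_ne_zero hL (neg_eq_zero.1 h)

/-- `1 ≠ -1` in `ZMod L` for `L ≥ 3`. [folklore] -/
private theorem zmod_one_ne_neg_one (hL : 2 < L) : (1 : ZMod L) ≠ -1 := by
  haveI : Fact (2 < L) := ⟨hL⟩
  exact fun h => ZMod.neg_one_ne_one h.symm

/-- The projection of a unit vector of `ℤ²` to the torus is the unit vector. [folklore] -/
private theorem proj_single (L : ℕ) (i : Fin 2) :
    Torus.proj L (Pi.single i (1 : ℤ) : Site 2) = Pi.single i 1 := by
  funext j
  rw [Torus.proj_apply]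
  by_cases h : j = i
  · subst h
    simp
  · simp [Pi.single_eq_of_ne h]

/-- The projection to the torus is odd. [folklore] -/
private theorem proj_neg (L : ℕ) (e : Site 2) : Torus.proj L (-e) = -Torus.proj L e := by
  funext j
  simp [Torus.proj_apply]

/-- Membership in `unitSteps`, unfolded. [folklore] -/
private theorem mem_unitSteps_iff (e : Site 2) :
    e ∈ unitSteps ↔ e = Pi.single 0 1 ∨ e = -Pi.single 0 1 ∨ e = Pi.single 1 1 ∨ e = -Pi.single 1 1 := by
  simp [unitSteps]

/-- For `L ≥ 2`, torus adjacency is "differ by the projection of a unit step". [cite: FriedliVelenik2017, §3.1] -/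
private theorem torusGraph_adj_iff_exists_unitSteps (hL : 2 ≤ L) (x y : TorusSite 2 L) :
    (torusGraph 2 L).Adj x y ↔ ∃ e ∈ unitSteps, y = x + Torus.proj L e := by
  rw [torusGraph_adj_iff]
  constructor
  · rintro ⟨-, ⟨i, rfl⟩ | ⟨i, rfl⟩⟩
    · refine ⟨Pi.single i 1, ?_, by rw [proj_single]⟩
      fin_cases i <;> simp [mem_unitSteps_iff]
    · refine ⟨-Pi.single i 1, ?_, by rw [proj_neg, proj_single, add_neg_cancel_right]⟩
      fin_cases i <;> simp [mem_unitSteps_iff]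
  · rintro ⟨e, he, rfl⟩
    have hne : ∀ i : Fin 2, x ≠ x + Pi.single i (1 : ZMod L) := by
      intro i h
      have h' := congr_fun h i
      rw [Pi.add_apply, Pi.single_eq_same] at h'
      exact zmod_one_ne_zero hL (left_eq_add.1 h')
    have hne' : ∀ i : Fin 2, x ≠ x + -Pi.single i (1 : ZMod L) := by
      intro i h
      have h' := congr_fun h i
      rw [Pi.add_apply, Pi.neg_apply, Pi.single_eq_same] at h'
      exact zmod_neg_one_ne_zero hL (left_eq_add.1 h')
    rcases (mem_unitSteps_iff e).1 he with rfl | rfl | rfl | rfl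
    · exact ⟨by rw [proj_single]; exact hne 0, Or.inl ⟨0, by rw [proj_single]⟩⟩
    · refine ⟨by rw [proj_neg, proj_single]; exact hne' 0, Or.inr ⟨0, ?_⟩⟩
      rw [proj_neg, proj_single, neg_add_cancel_right]
    · exact ⟨by rw [proj_single]; exact hne 1, Or.inl ⟨1, by rw [proj_single]⟩⟩
    · refine ⟨by rw [proj_neg, proj_single]; exact hne' 1, Or.inr ⟨1, ?_⟩⟩
      rw [proj_neg, proj_single, neg_add_cancel_right]

/-- For `L ≥ 3` the four unit steps from a torus site lead to four distinct sites. [cite: FriedliVelenik2017, §3.1] -/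
private theorem add_proj_injOn_unitSteps (hL : 2 < L) (x : TorusSite 2 L) :
    Set.InjOn (fun e : Site 2 => x + Torus.proj L e) ↑unitSteps := by
  have h10 := zmod_one_ne_zero hL.le
  have hm10 := zmod_neg_one_ne_zero hL.le
  have h1m1 := zmod_one_ne_neg_one hL
  intro e he e' he' h
  have h0 := congr_fun (add_left_cancel h) 0
  have h1 := congr_fun (add_left_cancel h) 1
  simp only [Torus.proj_apply] at h0 h1
  rw [Finset.mem_coe, mem_unitSteps_iff] at he he'
  rcases he with rfl | rfl | rfl | rfl <;> rcases he' with rfl | rfl | rfl | rfl <;>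
    first
    | rfl
    | (exfalso; simp at h0 h1; first
        | exact h10 h0 | exact h10 h0.symm | exact hm10 h0 | exact hm10 h0.symm
        | exact h1m1 h0 | exact h1m1 h0.symm
        | exact h10 h1 | exact h10 h1.symm | exact hm10 h1 | exact hm10 h1.symm
        | exact h1m1 h1 | exact h1m1 h1.symm)

/-- **Neighbour sums on the torus are unit-step sums** (`L ≥ 3`):
`Σ_{y ∼ x} F(y) = Σ_{e = ±e₁, ±e₂} F(x + e)`. [cite: FriedliVelenik2017, §3.1] -/
theorem sum_ite_torusGraph_adj_eq_sum_unitSteps [NeZero L] (hL : 2 < L) (x : TorusSite 2 L) {M : Type*}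
    [AddCommMonoid M] (F : TorusSite 2 L → M) :
    (∑ y : TorusSite 2 L, if (torusGraph 2 L).Adj x y then F y else 0) =
      ∑ e ∈ unitSteps, F (x + Torus.proj L e) := by
  rw [← Finset.sum_filter,
    ← Finset.sum_image (f := F) (s := unitSteps) (g := fun e : Site 2 => x + Torus.proj L e)
      (add_proj_injOn_unitSteps hL x)]
  refine Finset.sum_congr ?_ fun _ _ => rfl
  ext y
  rw [Finset.mem_filter, Finset.mem_image, torusGraph_adj_iff_exists_unitSteps hL.le]
  simp only [Finset.mem_univ, true_and]
  constructor
  · rintro ⟨e, he, rfl⟩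
    exact ⟨e, he, rfl⟩
  · rintro ⟨e, he, rfl⟩
    exact ⟨e, he, rfl⟩

/-- The bond sign between two fermionic-torus sites, computed on torus coordinates. [folklore] -/
private theorem spnDWaveBondSign_ofTorusSite [NeZero L] (x y : TorusSite 2 L) :
    spnDWaveBondSign L (FermionTorus.ofTorusSite x) (FermionTorus.ofTorusSite y) =
      if x 0 = y 0 then -1 else 1 := by
  unfold spnDWaveBondSign
  by_cases h : x 0 = y 0
  · rw [if_pos h, if_pos]
    exact Fin.ext (by rw [FermionTorus.ofLex_ofTorusSite_apply, FermionTorus.ofLex_ofTorusSite_apply, h])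
  · rw [if_neg h, if_neg]
    intro h'
    apply h
    apply ZMod.val_injective L
    have h'' := congrArg Fin.val h'
    rwa [FermionTorus.ofLex_ofTorusSite_apply, FermionTorus.ofLex_ofTorusSite_apply] at h''

/-- The unit vectors `±e₂` of `ℤ²` are not `±e₁`. [folklore] -/
private theorem single_one_ne :
    (Pi.single 1 (1 : ℤ) : Site 2) ≠ Pi.single 0 1 ∧ (Pi.single 1 (1 : ℤ) : Site 2) ≠ -Pi.single 0 1 ∧
      (-Pi.single 1 (1 : ℤ) : Site 2) ≠ Pi.single 0 1 ∧ (-Pi.single 1 (1 : ℤ) : Site 2) ≠ -Pi.single 0 1 := by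
  refine ⟨fun h => ?_, fun h => ?_, fun h => ?_, fun h => ?_⟩ <;>
  · have h' := congr_fun h 0
    simp at h'

/-- **The bond sign of a unit step is the `d`-wave form factor**: for `L ≥ 2` and a unit step `e`,
`g_d(x, x + e) = dWaveFormFactor e` (`+1` for `±e₁`, `-1` for `±e₂`). [cite: Scalapino1995, §2, eq. (2.3)] -/
theorem spnDWaveBondSign_ofTorusSite_add_proj [NeZero L] (hL : 2 ≤ L) (x : TorusSite 2 L) {e : Site 2}
    (he : e ∈ unitSteps) :
    spnDWaveBondSign L (FermionTorus.ofTorusSite x) (FermionTorus.ofTorusSite (x + Torus.proj L e)) =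
      ((dWaveFormFactor e : ℝ) : ℂ) := by
  rw [spnDWaveBondSign_ofTorusSite]
  simp only [Pi.add_apply, Torus.proj_apply, left_eq_add]
  have h10 := zmod_one_ne_zero hL
  have hm10 := zmod_neg_one_ne_zero hL
  obtain ⟨hn1, hn2, hn3, hn4⟩ := single_one_ne
  rcases (mem_unitSteps_iff e).1 he with rfl | rfl | rfl | rfl
  · simp [h10, dWaveFormFactor]
  · simp [hm10, dWaveFormFactor]
  · simp [dWaveFormFactor, hn1, hn2]
  · simp [dWaveFormFactor, hn3, hn4]

/-- `√2 · (g/√2) = g` for the coefficients of `localPair`. [folklore] -/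
private theorem sqrt_two_mul_coeff (g : ℝ) :
    (Real.sqrt 2 : ℂ) * ((g / Real.sqrt 2 : ℝ) : ℂ) = (g : ℂ) := by
  have h2 : (Real.sqrt 2 : ℂ) ≠ 0 := by
    exact_mod_cast (Real.sqrt_pos.2 (by norm_num : (0 : ℝ) < 2)).ne'
  rw [Complex.ofReal_div, mul_div_assoc', mul_div_cancel_left₀ _ h2]

/-- **The `d`-wave bond field is `√2 Δ_d`.** On the torus `(ℤ/Lℤ)²` with `L ≥ 3`,
`Σ_{x ∼ y ordered} g_d(x, y) Q_{xy} = √2 · pairField dWaveFormFactor L`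
(`pairField g L = Σ_x Σ_{e ∈ {0,±e₁,±e₂}} (g e/√2) Q_{x, x+e}` and `g_d(0) = 0`). Together with
`jwEmbed_flavourDWavePairField_one`: the flavour `d`-wave field at `n = 1` is `√2 Δ_d`, so
`⟨D†D⟩ = 2 ⟨Δ_d† Δ_d⟩` along the `n = 1` reduction. [cite: Scalapino1995, §2, eqs. (2.2)–(2.3)] -/
theorem dWaveBondField_eq_sqrt_two_smul_pairField (L : ℕ) [NeZero L] (hL : 2 < L) :
    dWaveBondField L = (Real.sqrt 2 : ℂ) • pairField dWaveFormFactor L := by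
  -- the right-hand side, site by site and step by step
  have hR : (Real.sqrt 2 : ℂ) • pairField dWaveFormFactor L =
      ∑ x : TorusSite 2 L, ∑ e ∈ unitSteps, ((dWaveFormFactor e : ℝ) : ℂ) •
        singletPairOp (FermionTorus.ofTorusSite x) (FermionTorus.ofTorusSite (x + Torus.proj L e)) := by
    rw [pairField, Finset.smul_sum]
    refine Finset.sum_congr rfl fun x _ => ?_
    rw [localPair, Finset.smul_sum, Finset.sum_insert_of_eq_zero_if_notMem (fun _ => by simp)]
    refine Finset.sum_congr rfl fun e _ => ?_
    rw [smul_smul, sqrt_two_mul_coeff, singletPairOp]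
  rw [hR, dWaveBondField, signedBondField, ← (FermionTorus.equivTorusSite (d := 2) (L := L)).symm.sum_comp]
  refine Finset.sum_congr rfl fun x _ => ?_
  rw [← (FermionTorus.equivTorusSite (d := 2) (L := L)).symm.sum_comp]
  have hsymm : ∀ z : TorusSite 2 L, (FermionTorus.equivTorusSite (d := 2) (L := L)).symm z =
      FermionTorus.ofTorusSite z := fun _ => rfl
  simp only [hsymm, fermionTorusGraph_adj, FermionTorus.toTorusSite_ofTorusSite]
  rw [sum_ite_torusGraph_adj_eq_sum_unitSteps hL x]
  refine Finset.sum_congr rfl fun e he => ?_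
  rw [spnDWaveBondSign_ofTorusSite_add_proj hL.le x he]

/-- Consequently, along the `n = 1` reduction the flavour `d`-wave field is `√2 Δ_d` (`L ≥ 3`).
[cite: Scalapino1995, §2] -/
theorem jwEmbed_flavourDWavePairField_one_eq (L : ℕ) [NeZero L] (hL : 2 < L) :
    jwEmbed (oneFlavourOrbEmb (FermionTorus 2 L)) (flavourDWavePairField 1 L) =
      (Real.sqrt 2 : ℂ) • pairField dWaveFormFactor L := by
  rw [jwEmbed_flavourDWavePairField_one, dWaveBondField_eq_sqrt_two_smul_pairField L hL]

end DWave

/-! ### The `n = 1` reduction on states: sector ground states and `⟨D†D⟩` correspond -/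

section ReductionStates

variable (L : ℕ)

/-- **Sector ground states correspond under the `n = 1` reduction**: `U ψ` is an `(N, S^z = M)`-sector
ground state of the torus `t`-`U`-`J` model iff `ψ` is one of the one-flavour `Sp(2)` pair-Hubbard
model (`U = fockCongr (oneFlavourOrbIso _)`, a unitary). [folklore] -/
theorem isGroundStateInSector_tUJTorus_fockCongr_iff (t U J : ℝ) (N : ℕ) (M : ℝ)
    (ψ : Fock (Orb (FermionTorus 2 L ×ₗ Fin 1))) :
    IsGroundStateInSector (tUJTorus L t U J) N M (fockCongr (oneFlavourOrbIso (FermionTorus 2 L)) ψ) ↔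
      IsGroundStateInSector (spnPairHubbardTorus 1 L t U J) N M ψ := by
  rw [← jwEmbed_spnPairHubbardTorus_one]
  exact isGroundStateInSector_fockCongr_iff _ _ N M ψ

/-- The same correspondence read from the `t`-`U`-`J` side (`U` is onto). [folklore] -/
theorem isGroundStateInSector_spnPairHubbardTorus_one_symm_iff (t U J : ℝ) (N : ℕ) (M : ℝ)
    (φ : Fock (Orb (FermionTorus 2 L))) :
    IsGroundStateInSector (spnPairHubbardTorus 1 L t U J) N M ((fockCongr (oneFlavourOrbIso (FermionTorus 2 L))).symm φ) ↔
      IsGroundStateInSector (tUJTorus L t U J) N M φ := by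
  rw [← isGroundStateInSector_tUJTorus_fockCongr_iff, LinearEquiv.apply_symm_apply]

/-- Norms correspond under the `n = 1` reduction. [folklore] -/
theorem star_fockCongr_oneFlavour_dotProduct (ψ φ : Fock (Orb (FermionTorus 2 L ×ₗ Fin 1))) :
    star (fockCongr (oneFlavourOrbIso (FermionTorus 2 L)) ψ) ⬝ᵥ fockCongr (oneFlavourOrbIso (FermionTorus 2 L)) φ =
      star ψ ⬝ᵥ φ :=
  star_fockCongr_dotProduct _ ψ φ

/-- `⟨ψ, (c • X)† (c • X) ψ⟩ = (star c * c) ⟨ψ, X† X ψ⟩`. [folklore] -/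
private theorem expect_conjTranspose_smul_mul_smul {κ : Type*} [LinearOrder κ] [Fintype κ] (c : ℂ)
    (X : Matrix (Finset κ) (Finset κ) ℂ) (φ : Fock κ) :
    expect ((c • X)ᴴ * (c • X)) φ = star c * c * expect (Xᴴ * X) φ := by
  rw [conjTranspose_smul, smul_mul_assoc, mul_smul_comm, smul_smul, expect, expect, smul_mulVec,
    dotProduct_smul, smul_eq_mul]

/-- **`⟨D†D⟩` corresponds to `2⟨Δ_d† Δ_d⟩` under the `n = 1` reduction** (`L ≥ 3`): for every state `ψ`
of the one-flavour model, `⟨ψ, D†D ψ⟩ = 2 ⟨Uψ, Δ_d† Δ_d Uψ⟩` with `D = flavourDWavePairField 1 L` and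
`Δ_d = pairField dWaveFormFactor L`. [cite: Scalapino1995, §2] -/
theorem expect_flavourDWavePairField_one (hL : 2 < L) [NeZero L] (ψ : Fock (Orb (FermionTorus 2 L ×ₗ Fin 1))) :
    expect ((flavourDWavePairField 1 L)ᴴ * flavourDWavePairField 1 L) ψ =
      2 * expect ((pairField dWaveFormFactor L)ᴴ * pairField dWaveFormFactor L)
        (fockCongr (oneFlavourOrbIso (FermionTorus 2 L)) ψ) := by
  rw [← expect_jwEmbed_fockCongr (oneFlavourOrbIso (FermionTorus 2 L)), jwEmbed_mul, jwEmbed_conjTranspose,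
    jwEmbed_flavourDWavePairField_one_eq L hL, expect_conjTranspose_smul_mul_smul]
  congr 1
  rw [Complex.star_def, Complex.conj_ofReal, ← Complex.ofReal_mul, Real.mul_self_sqrt zero_le_two,
    Complex.ofReal_ofNat]

end ReductionStates

/-! ## `Sp(2n)` invariance of the pair-Hubbard Hamiltonian (proofs)

`[H_n, E_{mm'}] = 0`, `[H_n, F_{mm'}] = 0`, `[H_n, F_{mm'}†] = 0` for the second-quantised generators
`E_{mm'} = flavourRotation n m m'` (`𝔲(n)`), `F_{mm'} = flavourSpinFlip n m m'` and their adjoints,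
which together span `𝔰𝔭(2n, ℂ)`. Mechanism (Sachdev–Read 1991 §1: `𝒥^{ab} c_a c_b` is an `Sp(N)`
singlet because of `Uᵀ𝒥U = 𝒥`): a site-summed bilinear `S = Σ_z c†_{z a} c_{z b}` has
`[S, c_{x p} c_{y q}] = δ_{aq} c_{y b} c_{x p} - δ_{ap} c_{x b} c_{y q}`, so `[S, P_x]` and `[S, B_{xy}]`
are single pair operators, and for the symplectic combinations these cancel in pairs by the CAR
`c c' + c' c = 0`; the flavour-diagonal hopping `Σ_{kσ} c†_{xkσ} c_{ykσ}` commutes with every `S`. -/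

section SpnInvariance

variable {ι : Type*} [LinearOrder ι] [Fintype ι]

/-- The commutator of a hopping bilinear with an annihilation pair:
`[c†_a c_b, c_p c_q] = δ_{aq} c_b c_p - δ_{ap} c_b c_q`. [cite: BratteliRobinsonII1997, §5.2.2 (CAR)] -/
theorem creation_annihilation_commutator_pair (a b p q : ι) :
    creation a * annihilation b * (annihilation p * annihilation q) -
        annihilation p * annihilation q * (creation a * annihilation b) =
      (if a = q then annihilation b * annihilation p else 0) -
        (if a = p then annihilation b * annihilation q else 0) := by
  have hb : annihilation b * (annihilation p * annihilation q) =
      annihilation p * annihilation q * annihilation b := by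
    rw [← mul_assoc, LiebThm1.annihilation_mul_annihilation_eq_neg b p, neg_mul, mul_assoc,
      LiebThm1.annihilation_mul_annihilation_eq_neg b q, mul_neg, neg_neg, ← mul_assoc]
  have hpq : annihilation p * annihilation q * creation a =
      (if q = a then annihilation p else 0) - (if p = a then annihilation q else 0) +
        creation a * (annihilation p * annihilation q) := by
    rw [mul_assoc, annihilation_mul_creation q a, mul_sub, ← mul_assoc, annihilation_mul_creation p a, sub_mul]
    split_ifs <;> noncomm_ring
  have hbp := LiebThm1.annihilation_mul_annihilation_eq_neg p b
  have hbq := LiebThm1.annihilation_mul_annihilation_eq_neg q b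
  have step : creation a * annihilation b * (annihilation p * annihilation q) -
      annihilation p * annihilation q * (creation a * annihilation b) =
      -(((if q = a then annihilation p else 0) - (if p = a then annihilation q else 0)) * annihilation b) := by
    rw [mul_assoc (creation a), hb, ← mul_assoc (annihilation p * annihilation q), hpq]
    noncomm_ring
  rw [step]
  by_cases hq : a = q
  · subst hq
    by_cases hp : a = p
    · subst hp
      simp only [if_true, sub_self, zero_mul, neg_zero]
    · rw [if_pos rfl, if_neg (Ne.symm hp), if_pos rfl, if_neg hp, sub_zero, sub_zero, hbp, neg_neg]
  · by_cases hp : a = p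
    · subst hp
      rw [if_neg (Ne.symm hq), if_pos rfl, if_neg hq, if_pos rfl, zero_sub, zero_sub, neg_mul, neg_neg, hbq]
    · rw [if_neg (Ne.symm hq), if_neg (Ne.symm hp), if_neg hq, if_neg hp, sub_zero, zero_mul, neg_zero]

/-- A Kronecker sum with a spectator condition: `Σ_k [a = k ∧ P] f k = [P] f a`. [folklore] -/
private theorem sum_ite_eq_and {α M : Type*} [Fintype α] [DecidableEq α] [AddCommMonoid M] (a : α) (P : Prop)
    [Decidable P] (f : α → M) :
    (∑ k, if a = k ∧ P then f k else 0) = if P then f a else 0 := by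
  simp_rw [ite_and]
  simp only [Finset.sum_ite_eq, Finset.mem_univ, if_true]

/-- A Kronecker sum with a spectator condition: `Σ_k [k = a ∧ P] f k = [P] f a`. [folklore] -/
private theorem sum_ite_eq_and' {α M : Type*} [Fintype α] [DecidableEq α] [AddCommMonoid M] (a : α) (P : Prop)
    [Decidable P] (f : α → M) :
    (∑ k, if k = a ∧ P then f k else 0) = if P then f a else 0 := by
  simp_rw [ite_and]
  simp only [Finset.sum_ite_eq', Finset.mem_univ, if_true]

/-- The commutator of two finite sums, term by term: `[Σ f, Σ g] = Σ_i Σ_j [f_i, g_j]`. [folklore] -/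
private theorem sum_mul_sum_sub_comm {R κ μ : Type*} [NonUnitalNonAssocRing R] (s : Finset κ) (t : Finset μ)
    (f : κ → R) (g : μ → R) :
    (∑ i ∈ s, f i) * (∑ j ∈ t, g j) - (∑ j ∈ t, g j) * (∑ i ∈ s, f i) =
      ∑ i ∈ s, ∑ j ∈ t, (f i * g j - g j * f i) := by
  rw [Finset.sum_mul_sum, Finset.sum_mul_sum,
    Finset.sum_comm (s := t) (t := s) (f := fun j i => g j * f i), ← Finset.sum_sub_distrib]
  refine Finset.sum_congr rfl fun i _ => ?_
  rw [← Finset.sum_sub_distrib]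

variable {Λ : Type*} [LinearOrder Λ] [Fintype Λ] {n : ℕ}

omit [LinearOrder Λ] [Fintype Λ] in
/-- Two flavoured orbitals coincide iff sites, flavours and spins do. [folklore] -/
@[simp] theorem flavourOrb_eq_iff {x z : Λ} {m k : Fin n} {σ τ : Fin 2} :
    orb (toLex (x, m)) σ = orb (toLex (z, k)) τ ↔ x = z ∧ m = k ∧ σ = τ := by
  rw [orb_eq_orb_iff, toLex_inj, Prod.mk.injEq, and_assoc]

/-- The CAR for flavoured annihilators: `c c' + c' c = 0`. [cite: BratteliRobinsonII1997, §5.2.2 (5.2.11)] -/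
theorem flavourAnnihilation_anticomm (x y : Λ) (m k : Fin n) (σ τ : Fin 2) :
    flavourAnnihilation n x m σ * flavourAnnihilation n y k τ +
      flavourAnnihilation n y k τ * flavourAnnihilation n x m σ = 0 :=
  annihilation_anticommute_holds _ _

/-- **The basic commutator**: for the site-summed bilinear `S = Σ_z c†_{z a} c_{z b}` (`a = (m_a, σ_a)`,
`b = (m_b, σ_b)`) and a pair `c_{x p} c_{y q}`,
`[S, c_{x p} c_{y q}] = δ_{a q} c_{y b} c_{x p} - δ_{a p} c_{x b} c_{y q}`. [cite: SachdevRead1991, §1] -/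
theorem siteSum_commutator_pair (ma mb mp mq : Fin n) (σa σb σp σq : Fin 2) (x y : Λ) :
    (∑ z : Λ, (flavourAnnihilation n z ma σa)ᴴ * flavourAnnihilation n z mb σb) *
        (flavourAnnihilation n x mp σp * flavourAnnihilation n y mq σq) -
      flavourAnnihilation n x mp σp * flavourAnnihilation n y mq σq *
        (∑ z : Λ, (flavourAnnihilation n z ma σa)ᴴ * flavourAnnihilation n z mb σb) =
    (if ma = mq ∧ σa = σq then flavourAnnihilation n y mb σb * flavourAnnihilation n x mp σp else 0) -
      (if ma = mp ∧ σa = σp then flavourAnnihilation n x mb σb * flavourAnnihilation n y mq σq else 0) := by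
  rw [Finset.sum_mul, Finset.mul_sum, ← Finset.sum_sub_distrib]
  simp only [flavourAnnihilation_eq, annihilation_conjTranspose, creation_annihilation_commutator_pair,
    flavourOrb_eq_iff]
  rw [Finset.sum_sub_distrib, sum_ite_eq_and', sum_ite_eq_and']

/-- `[S, P_x]` is a single pair: `[S, P_x] = [σ_a = ↑] c_{x b} c_{x m_a ↓} - [σ_a = ↓] c_{x b} c_{x m_a ↑}`.
[cite: SachdevRead1991, §1] -/
theorem siteSum_commutator_onSiteSingletPair (ma mb : Fin n) (σa σb : Fin 2) (x : Λ) :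
    (∑ z : Λ, (flavourAnnihilation n z ma σa)ᴴ * flavourAnnihilation n z mb σb) * onSiteSingletPair n x -
      onSiteSingletPair n x * (∑ z : Λ, (flavourAnnihilation n z ma σa)ᴴ * flavourAnnihilation n z mb σb) =
    (if σa = 0 then flavourAnnihilation n x mb σb * flavourAnnihilation n x ma 1 else 0) -
      (if σa = 1 then flavourAnnihilation n x mb σb * flavourAnnihilation n x ma 0 else 0) := by
  unfold onSiteSingletPair
  rw [Finset.mul_sum, Finset.sum_mul, ← Finset.sum_sub_distrib]
  simp only [siteSum_commutator_pair]
  rw [Finset.sum_sub_distrib, sum_ite_eq_and, sum_ite_eq_and]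

omit [LinearOrder Λ] in
/-- `[S, A - B] = [S, A] - [S, B]`. [folklore] -/
private theorem commutator_sub_aux (S A B : Matrix (Finset (Orb (Λ ×ₗ Fin n))) (Finset (Orb (Λ ×ₗ Fin n))) ℂ) :
    S * (A - B) - (A - B) * S = (S * A - A * S) - (S * B - B * S) := by
  noncomm_ring

/-- `[S, B_{xy}]` is a sum of single pairs:
`[S, B_{xy}] = [σ_a = ↓] (c_{y b} c_{x m_a ↑} + c_{x b} c_{y m_a ↑}) - [σ_a = ↑] (c_{x b} c_{y m_a ↓} + c_{y b} c_{x m_a ↓})`.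
[cite: SachdevRead1991, §1] -/
theorem siteSum_commutator_bondSingletPair (ma mb : Fin n) (σa σb : Fin 2) (x y : Λ) :
    (∑ z : Λ, (flavourAnnihilation n z ma σa)ᴴ * flavourAnnihilation n z mb σb) * bondSingletPair n x y -
      bondSingletPair n x y * (∑ z : Λ, (flavourAnnihilation n z ma σa)ᴴ * flavourAnnihilation n z mb σb) =
    (if σa = 1 then flavourAnnihilation n y mb σb * flavourAnnihilation n x ma 0 +
        flavourAnnihilation n x mb σb * flavourAnnihilation n y ma 0 else 0) -
      (if σa = 0 then flavourAnnihilation n x mb σb * flavourAnnihilation n y ma 1 +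
        flavourAnnihilation n y mb σb * flavourAnnihilation n x ma 1 else 0) := by
  unfold bondSingletPair
  rw [Finset.mul_sum, Finset.sum_mul, ← Finset.sum_sub_distrib]
  simp only [commutator_sub_aux]
  simp only [siteSum_commutator_pair]
  rw [Finset.sum_sub_distrib, Finset.sum_sub_distrib, Finset.sum_sub_distrib, sum_ite_eq_and, sum_ite_eq_and,
    sum_ite_eq_and, sum_ite_eq_and]
  by_cases h : σa = 0
  · subst h
    simp only [if_true, (by decide : (0 : Fin 2) ≠ 1), if_false, zero_sub, sub_zero]
    abel
  · have h1 : σa = 1 := Fin.eq_one_of_ne_zero σa h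
    subst h1
    simp only [if_true, (by decide : (1 : Fin 2) ≠ 0), if_false, zero_sub, sub_zero]
    abel

/-- **A site-summed bilinear commutes with the flavour-diagonal hopping between two sites**:
`[Σ_z c†_{za} c_{zb}, Σ_{kσ} c†_{xkσ} c_{ykσ}] = c†_{xa} c_{yb} - c†_{xa} c_{yb} = 0`. [cite: SachdevRead1991, §4] -/
theorem siteSum_commute_hoppingPair (ma mb : Fin n) (σa σb : Fin 2) (x y : Λ) :
    Commute (∑ k : Fin n, ∑ σ : Fin 2, (flavourAnnihilation n x k σ)ᴴ * flavourAnnihilation n y k σ)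
      (∑ z : Λ, (flavourAnnihilation n z ma σa)ᴴ * flavourAnnihilation n z mb σb) := by
  rw [Commute, SemiconjBy, ← sub_eq_zero, sum_mul_sum_sub_comm]
  simp_rw [Finset.sum_mul, Finset.mul_sum, ← Finset.sum_sub_distrib]
  simp only [flavourAnnihilation_eq, annihilation_conjTranspose, LiebThm1.creation_mul_annihilation_commutator,
    flavourOrb_eq_iff, Finset.sum_sub_distrib, ite_and, Finset.sum_ite_irrel, Finset.sum_ite_eq,
    Finset.sum_ite_eq', Finset.sum_const_zero, Finset.mem_univ, if_true, sub_self]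

/-! #### The generators against `P_x`, `B_{xy}` and the hopping -/

omit [LinearOrder Λ] in
/-- `[A - A', P] = [A, P] - [A', P]`. [folklore] -/
private theorem sub_commutator_aux (A A' P : Matrix (Finset (Orb (Λ ×ₗ Fin n))) (Finset (Orb (Λ ×ₗ Fin n))) ℂ) :
    (A - A') * P - P * (A - A') = (A * P - P * A) - (A' * P - P * A') := by
  noncomm_ring

omit [LinearOrder Λ] in
/-- `[A + A', P] = [A, P] + [A', P]`. [folklore] -/
private theorem add_commutator_aux (A A' P : Matrix (Finset (Orb (Λ ×ₗ Fin n))) (Finset (Orb (Λ ×ₗ Fin n))) ℂ) :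
    (A + A') * P - P * (A + A') = (A * P - P * A) + (A' * P - P * A') := by
  noncomm_ring

/-- `[E_{mm'}, P_x] = 0`. [cite: SachdevRead1991, §4] -/
theorem flavourRotation_commute_onSiteSingletPair (m m' : Fin n) (x : Λ) :
    Commute (flavourRotation n m m') (onSiteSingletPair n x) := by
  have h1 := siteSum_commutator_onSiteSingletPair (n := n) m m' 0 0 x
  have h2 := siteSum_commutator_onSiteSingletPair (n := n) m' m 1 1 x
  simp only [if_true, (by decide : (0 : Fin 2) ≠ 1), (by decide : (1 : Fin 2) ≠ 0), if_false,
    sub_zero, zero_sub] at h1 h2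
  rw [Commute, SemiconjBy, ← sub_eq_zero, flavourRotation, Finset.sum_sub_distrib, sub_commutator_aux, h1, h2,
    sub_neg_eq_add, flavourAnnihilation_anticomm]

/-- `[E_{mm'}, B_{xy}] = 0`. [cite: SachdevRead1991, §4] -/
theorem flavourRotation_commute_bondSingletPair (m m' : Fin n) (x y : Λ) :
    Commute (flavourRotation n m m') (bondSingletPair n x y) := by
  have h1 := siteSum_commutator_bondSingletPair (n := n) m m' 0 0 x y
  have h2 := siteSum_commutator_bondSingletPair (n := n) m' m 1 1 x y
  simp only [if_true, (by decide : (0 : Fin 2) ≠ 1), (by decide : (1 : Fin 2) ≠ 0), if_false,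
    sub_zero, zero_sub] at h1 h2
  rw [Commute, SemiconjBy, ← sub_eq_zero, flavourRotation, Finset.sum_sub_distrib, sub_commutator_aux, h1, h2]
  calc -(flavourAnnihilation n x m' 0 * flavourAnnihilation n y m 1 +
            flavourAnnihilation n y m' 0 * flavourAnnihilation n x m 1) -
          (flavourAnnihilation n y m 1 * flavourAnnihilation n x m' 0 +
            flavourAnnihilation n x m 1 * flavourAnnihilation n y m' 0)
      = -(flavourAnnihilation n x m' 0 * flavourAnnihilation n y m 1 +
            flavourAnnihilation n y m 1 * flavourAnnihilation n x m' 0) -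
          (flavourAnnihilation n y m' 0 * flavourAnnihilation n x m 1 +
            flavourAnnihilation n x m 1 * flavourAnnihilation n y m' 0) := by abel
    _ = 0 := by rw [flavourAnnihilation_anticomm, flavourAnnihilation_anticomm, neg_zero, sub_zero]

/-- `[F_{mm'}, P_x] = 0`. [cite: SachdevRead1991, §4] -/
theorem flavourSpinFlip_commute_onSiteSingletPair (m m' : Fin n) (x : Λ) :
    Commute (flavourSpinFlip n m m') (onSiteSingletPair n x) := by
  have h1 := siteSum_commutator_onSiteSingletPair (n := n) m m' 0 1 x
  have h2 := siteSum_commutator_onSiteSingletPair (n := n) m' m 0 1 x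
  simp only [if_true, (by decide : (0 : Fin 2) ≠ 1), if_false, sub_zero] at h1 h2
  rw [Commute, SemiconjBy, ← sub_eq_zero, flavourSpinFlip, Finset.sum_add_distrib, add_commutator_aux, h1, h2,
    flavourAnnihilation_anticomm]

/-- `[F_{mm'}, B_{xy}] = 0`. [cite: SachdevRead1991, §4] -/
theorem flavourSpinFlip_commute_bondSingletPair (m m' : Fin n) (x y : Λ) :
    Commute (flavourSpinFlip n m m') (bondSingletPair n x y) := by
  have h1 := siteSum_commutator_bondSingletPair (n := n) m m' 0 1 x y
  have h2 := siteSum_commutator_bondSingletPair (n := n) m' m 0 1 x y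
  simp only [if_true, (by decide : (0 : Fin 2) ≠ 1), if_false, zero_sub] at h1 h2
  rw [Commute, SemiconjBy, ← sub_eq_zero, flavourSpinFlip, Finset.sum_add_distrib, add_commutator_aux, h1, h2]
  calc -(flavourAnnihilation n x m' 1 * flavourAnnihilation n y m 1 +
            flavourAnnihilation n y m' 1 * flavourAnnihilation n x m 1) +
          -(flavourAnnihilation n x m 1 * flavourAnnihilation n y m' 1 +
            flavourAnnihilation n y m 1 * flavourAnnihilation n x m' 1)
      = -((flavourAnnihilation n x m' 1 * flavourAnnihilation n y m 1 +
            flavourAnnihilation n y m 1 * flavourAnnihilation n x m' 1) +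
          (flavourAnnihilation n y m' 1 * flavourAnnihilation n x m 1 +
            flavourAnnihilation n x m 1 * flavourAnnihilation n y m' 1)) := by abel
    _ = 0 := by rw [flavourAnnihilation_anticomm, flavourAnnihilation_anticomm, add_zero, neg_zero]

/-- The adjoint of `F_{mm'}` as a sum of site bilinears: `F† = Σ_z (c†_{zm'↓} c_{zm↑} + c†_{zm↓} c_{zm'↑})`. [folklore] -/
theorem flavourSpinFlip_conjTranspose (m m' : Fin n) :
    (flavourSpinFlip n m m' : Matrix (Finset (Orb (Λ ×ₗ Fin n))) _ ℂ)ᴴ =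
      ∑ z : Λ, ((flavourAnnihilation n z m' 1)ᴴ * flavourAnnihilation n z m 0 +
        (flavourAnnihilation n z m 1)ᴴ * flavourAnnihilation n z m' 0) := by
  rw [flavourSpinFlip, conjTranspose_sum]
  refine Finset.sum_congr rfl fun z _ => ?_
  rw [conjTranspose_add, conjTranspose_mul, conjTranspose_mul, conjTranspose_conjTranspose,
    conjTranspose_conjTranspose]

/-- `[F_{mm'}†, P_x] = 0`. [cite: SachdevRead1991, §4] -/
theorem flavourSpinFlip_conjTranspose_commute_onSiteSingletPair (m m' : Fin n) (x : Λ) :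
    Commute (flavourSpinFlip n m m')ᴴ (onSiteSingletPair n x) := by
  have h1 := siteSum_commutator_onSiteSingletPair (n := n) m' m 1 0 x
  have h2 := siteSum_commutator_onSiteSingletPair (n := n) m m' 1 0 x
  simp only [if_true, (by decide : (1 : Fin 2) ≠ 0), if_false, zero_sub] at h1 h2
  rw [Commute, SemiconjBy, ← sub_eq_zero, flavourSpinFlip_conjTranspose, Finset.sum_add_distrib, add_commutator_aux,
    h1, h2, ← neg_add, flavourAnnihilation_anticomm, neg_zero]

/-- `[F_{mm'}†, B_{xy}] = 0`. [cite: SachdevRead1991, §4] -/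
theorem flavourSpinFlip_conjTranspose_commute_bondSingletPair (m m' : Fin n) (x y : Λ) :
    Commute (flavourSpinFlip n m m')ᴴ (bondSingletPair n x y) := by
  have h1 := siteSum_commutator_bondSingletPair (n := n) m' m 1 0 x y
  have h2 := siteSum_commutator_bondSingletPair (n := n) m m' 1 0 x y
  simp only [if_true, (by decide : (1 : Fin 2) ≠ 0), if_false, sub_zero] at h1 h2
  rw [Commute, SemiconjBy, ← sub_eq_zero, flavourSpinFlip_conjTranspose, Finset.sum_add_distrib, add_commutator_aux,
    h1, h2]
  calc flavourAnnihilation n y m 0 * flavourAnnihilation n x m' 0 +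
            flavourAnnihilation n x m 0 * flavourAnnihilation n y m' 0 +
          (flavourAnnihilation n y m' 0 * flavourAnnihilation n x m 0 +
            flavourAnnihilation n x m' 0 * flavourAnnihilation n y m 0)
      = (flavourAnnihilation n y m 0 * flavourAnnihilation n x m' 0 +
            flavourAnnihilation n x m' 0 * flavourAnnihilation n y m 0) +
          (flavourAnnihilation n x m 0 * flavourAnnihilation n y m' 0 +
            flavourAnnihilation n y m' 0 * flavourAnnihilation n x m 0) := by abel
    _ = 0 := by rw [flavourAnnihilation_anticomm, flavourAnnihilation_anticomm, add_zero]

/-! #### Assembly: the generators commute with `H_n` -/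

variable (G : SimpleGraph Λ) [DecidableRel G.Adj]

/-- The hopping term with the flavour–spin sum innermost. [folklore] -/
theorem flavourHopping_eq_sum_ite (n : ℕ) :
    flavourHopping G n = ∑ x : Λ, ∑ y : Λ, if G.Adj x y then
      ∑ k : Fin n, ∑ σ : Fin 2, (flavourAnnihilation n x k σ)ᴴ * flavourAnnihilation n y k σ else 0 := by
  unfold flavourHopping
  refine Finset.sum_congr rfl fun x _ => Finset.sum_congr rfl fun y _ => ?_
  by_cases h : G.Adj x y <;> simp [h]

/-- A generator commutes with `H_n` as soon as it and its adjoint commute with every `P_x` and every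
`B_{xy}`, and it commutes with the flavour-diagonal hopping between any two sites. [cite: SachdevRead1991, §4] -/
theorem spnPairHubbard_commute_of (X : Matrix (Finset (Orb (Λ ×ₗ Fin n))) (Finset (Orb (Λ ×ₗ Fin n))) ℂ)
    (hT : ∀ x y : Λ, Commute (∑ k : Fin n, ∑ σ : Fin 2,
      (flavourAnnihilation n x k σ)ᴴ * flavourAnnihilation n y k σ) X)
    (hP : ∀ x : Λ, Commute X (onSiteSingletPair n x)) (hP' : ∀ x : Λ, Commute Xᴴ (onSiteSingletPair n x))
    (hB : ∀ x y : Λ, Commute X (bondSingletPair n x y)) (hB' : ∀ x y : Λ, Commute Xᴴ (bondSingletPair n x y))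
    (t U J : ℝ) : Commute (spnPairHubbard G n t U J) X := by
  have hPc : ∀ x : Λ, Commute ((onSiteSingletPair n x)ᴴ * onSiteSingletPair n x) X := by
    intro x
    refine Commute.mul_left ?_ (hP x).symm
    have h := congrArg conjTranspose (hP' x).eq
    rw [conjTranspose_mul, conjTranspose_mul, conjTranspose_conjTranspose] at h
    exact h
  have hBc : ∀ x y : Λ, Commute ((bondSingletPair n x y)ᴴ * bondSingletPair n x y) X := by
    intro x y
    refine Commute.mul_left ?_ (hB x y).symm
    have h := congrArg conjTranspose (hB' x y).eq
    rw [conjTranspose_mul, conjTranspose_mul, conjTranspose_conjTranspose] at h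
    exact h
  unfold spnPairHubbard
  refine Commute.sub_left (Commute.add_left (Commute.smul_left ?_ _) (Commute.smul_left ?_ _))
    (Commute.smul_left ?_ _)
  · rw [flavourHopping_eq_sum_ite]
    refine Commute.sum_left _ _ _ fun x _ => Commute.sum_left _ _ _ fun y _ => ?_
    split_ifs
    · exact hT x y
    · exact Commute.zero_left _
  · exact Commute.sum_left _ _ _ fun x _ => hPc x
  · refine Commute.sum_left _ _ _ fun x _ => Commute.sum_left _ _ _ fun y _ => ?_
    split_ifs
    · exact hBc x y
    · exact Commute.zero_left _

/-- The adjoint of a flavour rotation is a flavour rotation: `E_{mm'}† = E_{m'm}`. [folklore] -/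
theorem flavourRotation_conjTranspose (m m' : Fin n) :
    (flavourRotation n m m' : Matrix (Finset (Orb (Λ ×ₗ Fin n))) _ ℂ)ᴴ = flavourRotation n m' m := by
  rw [flavourRotation, flavourRotation, conjTranspose_sum]
  refine Finset.sum_congr rfl fun z _ => ?_
  rw [conjTranspose_sub, conjTranspose_mul, conjTranspose_mul, conjTranspose_conjTranspose,
    conjTranspose_conjTranspose]

/-- **`Sp(2n)` invariance, `𝔲(n)` part**: `[H_n, E_{mm'}] = 0` for all flavours `m, m'` (flavour
rotations; in particular `H_n` is invariant under flavour permutations and the Cartan torus).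
[cite: SachdevRead1991, §4] -/
theorem spnPairHubbard_commute_flavourRotation (t U J : ℝ) (m m' : Fin n) :
    Commute (spnPairHubbard G n t U J) (flavourRotation n m m') := by
  refine spnPairHubbard_commute_of G _ (fun x y => ?_)
    (flavourRotation_commute_onSiteSingletPair m m')
    (fun x => by rw [flavourRotation_conjTranspose]; exact flavourRotation_commute_onSiteSingletPair m' m x)
    (flavourRotation_commute_bondSingletPair m m')
    (fun x y => by rw [flavourRotation_conjTranspose]; exact flavourRotation_commute_bondSingletPair m' m x y)
    t U J
  rw [flavourRotation, Finset.sum_sub_distrib]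
  exact Commute.sub_right (siteSum_commute_hoppingPair m m' 0 0 x y) (siteSum_commute_hoppingPair m' m 1 1 x y)

/-- **`Sp(2n)` invariance, symmetric part**: `[H_n, F_{mm'}] = 0` for all flavours `m, m'`.
[cite: SachdevRead1991, §4] -/
theorem spnPairHubbard_commute_flavourSpinFlip (t U J : ℝ) (m m' : Fin n) :
    Commute (spnPairHubbard G n t U J) (flavourSpinFlip n m m') := by
  refine spnPairHubbard_commute_of G _ (fun x y => ?_)
    (flavourSpinFlip_commute_onSiteSingletPair m m')
    (flavourSpinFlip_conjTranspose_commute_onSiteSingletPair m m')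
    (flavourSpinFlip_commute_bondSingletPair m m')
    (flavourSpinFlip_conjTranspose_commute_bondSingletPair m m') t U J
  rw [flavourSpinFlip, Finset.sum_add_distrib]
  exact Commute.add_right (siteSum_commute_hoppingPair m m' 0 1 x y) (siteSum_commute_hoppingPair m' m 0 1 x y)

/-- **`Sp(2n)` invariance, lowering part**: `[H_n, F_{mm'}†] = 0` (adjoint of the previous, `H_n`
Hermitian). [cite: SachdevRead1991, §4] -/
theorem spnPairHubbard_commute_flavourSpinFlip_conjTranspose (t U J : ℝ) (m m' : Fin n) :
    Commute (spnPairHubbard G n t U J) (flavourSpinFlip n m m')ᴴ := by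
  have h := congrArg conjTranspose (spnPairHubbard_commute_flavourSpinFlip G t U J m m').eq
  rw [conjTranspose_mul, conjTranspose_mul, (spnPairHubbard_isHermitian G n t U J).eq] at h
  exact h.symm

/-- The torus model is `Sp(2n)`-invariant: it commutes with all `E_{mm'}`, `F_{mm'}`, `F_{mm'}†`.
[cite: SachdevRead1991, §4] -/
theorem spnPairHubbardTorus_commute_generators (n L : ℕ) (t U J : ℝ) (m m' : Fin n) :
    Commute (spnPairHubbardTorus n L t U J) (flavourRotation n m m') ∧
      Commute (spnPairHubbardTorus n L t U J) (flavourSpinFlip n m m') ∧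
      Commute (spnPairHubbardTorus n L t U J) (flavourSpinFlip n m m')ᴴ :=
  ⟨spnPairHubbard_commute_flavourRotation _ t U J m m', spnPairHubbard_commute_flavourSpinFlip _ t U J m m',
    spnPairHubbard_commute_flavourSpinFlip_conjTranspose _ t U J m m'⟩

end SpnInvariance

end Literature.MathematicalPhysics.QuantumLattice

end
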